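import Literature.NumberTheory.LFunctions.ZetaScrewGrowthMoments
import Literature.NumberTheory.LFunctions.ZetaScrewThm17Proofs
import Literature.NumberTheory.LFunctions.ZetaScrewProofs
import Literature.NumberTheory.LFunctions.FordZetaZeroRecipSqSum
import Literature.NumberTheory.LFunctions.XiMoments
import Literature.NumberTheory.LFunctions.FreitasLiHalfPlanesProofs
import Mathlib.MeasureTheory.Integral.ExpDecay
import Mathlib.Analysis.Matrix.PosDef
import Mathlib.MeasureTheory.Integral.Prod
import Mathlib.Analysis.SpecialFunctions.ImproperIntegrals
import Mathlib.Analysis.Calculus.IteratedDeriv.Lemmas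
import Mathlib.MeasureTheory.Integral.DominatedConvergence
import HarnessLib

/-!
# Suzuki's Theorem 1.6 (`RH ⟺ Ψ = O(1)`), the non-integrability of `Ψ`, Thm 1.8 (necessity),
# the transform (11.2) of `Ψ_ω`, Thm 11.1 (sufficiency), the moment formula (1.15) and the
# Li-coefficient relations Thm 8.1 / Thm 8.2: proofs

LINE 1 — LABEL: RH-FREE corpus literature (proofs of printed statements); the discharged fact
`Suzuki2023_thm16` is RH-EQUIVALENT (both directions proved here, so the tree now KNOWS which
bound on `Ψ` is equivalent to RH — it does not know the bound); `Suzuki2023_zetaScrew_notMemLp`,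
`Suzuki2023_eq112`, `Suzuki2023_thm81`, `Suzuki2023_thm81_inv` and `Suzuki2023_thm82` are RH-FREE
(identities between the two criterion sequences `λ_n` [Li97] and `μ_n` [Suzuki2023 Thm 1.8]: they fix
the dictionary, not a sign); `Suzuki2023_thm18_mp` is an RH-CONSEQUENCE. bears_on: LADDER-RH
B-C/B-P (COLUMN 6; object `Ψ` = COLUMN 1's `zetaScrew`).
WHAT THIS IS NOT: not progress toward RH; proving a criterion fixes WHICH inequality would prove
RH, it does not move RH; nothing here bears on the truth of RH.

Sibling proofs file (D-0014 append protocol) of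
`Literature/NumberTheory/LFunctions/ZetaScrewGrowthMoments.lean`, following M. Suzuki, *Aspects of
the screw function corresponding to the Riemann zeta-function*, J. Lond. Math. Soc. (2) 108 (2023)
= arXiv:2206.03682 [Suzuki2023], §7.1 and the remark after Thm 1.6 (p. 3).

## A. The Laplace identity on the right half-plane (`ZetaScrewGrowth.F_mul_eq`)

If the Laplace integrals `∫₀^∞ Ψ(t)e^{-σ't}dt` converge absolutely for every `σ' > 0`
(informal shorthand in this docstring and the lemma docstrings: "`LaplaceIntegrable`"; in the
lemmas the hypothesis is spelled out), the transform (shorthand `F`; in the lemmas the tree's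
Mellin form `Landau.mellinIoi (Ψ ∘ log)` of `ZetaScrewThm17Proofs.lean` is spelled out) is holomorphic on `Re s > 0`
(`Landau.differentiableOn_mellinIoi_of_forall`) and, by Thm 1.1 (1)
(`ZetaScrewLandau.mellinIoi_eq_of_re_gt`: `F(s) = s^{-2}ξ'/ξ(1/2+s)` for `Re s > 1/2`) and the
identity theorem, `F(s)·s²·ξ(1/2+s) = ξ'(1/2+s)` on all of `Re s > 0`. At a zero `w₀` of
`ξ(1/2+·)` with `Re w₀ > 0` this is impossible by comparing orders of vanishing
(`ord ξ' + 1 = ord ξ` vs `ord(Gξ) ≥ ord ξ`; the argument of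
`ZetaScrewLandau.riemannXi_ne_zero_of_zetaScrew_nonneg`, here WITHOUT Landau's lemma since
absolute convergence is assumed outright): `riemannXi_ne_zero_of_laplace`,
`riemannHypothesis_of_laplace` (via `quasiRiemannHypothesis_one_half_iff_holds`).

## B. Thm 1.6 (`Suzuki2023_thm16_holds`)

`⟸` (printed: "the integral on the left-hand side of (1.2) converges absolutely and uniformly on
any compact subset in `ℂ₊`. Hence `(ξ'/ξ)(1/2-iz)` has no poles in `ℂ₊`"): a bounded `Ψ` is
`LaplaceIntegrable` (`laplaceIntegrable_of_bounded`), then §A. `⟹` (printed: "all `γ` in (1.3)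
are real … `|Ψ(t)| ≤ 2∑_γ|γ|^{-2} < ∞`"): by Thm 1.1 (2) under RH
(`ZetaScrewThm17.hasSum_real`: `Ψ(t) = ∑_ρ m(ρ)(1-cos γt)/γ²`, `γ = Im ρ`), each term is
`≤ 2m(ρ)/γ²`, summable by comparison with the tree's `∑ m(ρ)/|ρ|² < ∞`
(`FordL33.summable_order_div_norm_sq`, `|γ| > 14`): `abs_zetaScrew_le_of_RH`.

## C. `Ψ ∉ L¹(0,∞)`, `Ψ ∉ L²(0,∞)` (`Suzuki2023_zetaScrew_notMemLp_holds`)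

Printed: "formula (1.2) holds for `Im(z) > 0` and defines an analytic function in `ℂ₊` whose
extension to the real line is bounded or a function of `L²(ℝ)`, respectively … it contradicts
`z = 0` being a simple pole of the right-hand side." Concretely: in either case `Ψ` is
`LaplaceIntegrable` and `‖F(y)‖ ≤ ∫₀^∞|Ψ|e^{-yt} ≤ C/√y` for real `0 < y < 1` (`L¹`: `≤ ‖Ψ‖₁`;
`L²`: `2|Ψ|e^{-yt} ≤ Ψ²/√y + √y e^{-2yt}`), so by §A `ξ'(1/2+y) = F(y)y²ξ(1/2+y) = O(y^{3/2})`,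
whence `ξ''(1/2) = lim ξ'(1/2+y)/y = 0` (`ξ'(1/2) = 0` by the functional equation) —
contradicting `ξ''(1/2) > 0` (tree: `iteratedDeriv_two_mul_riemannXi_half_pos`, from the moment
representation of `ξ` on the critical line). The "simple pole at `z = 0`" of the source is
exactly `ξ''(1/2) ≠ 0`.

## D. The moments `μ_n` (1.13) converge absolutely (`integrableOn_zetaScrewMoment_integrand`)

From Thm 1.1 (3) (`Suzuki2023_thm11_growth_holds`): `|4^{-1}e^{-t/2}Ψ(t)tⁿ| ≤ (M/4) tⁿe^{-c√t}
≤ (M/4)·2max(1, (2n+4)!c^{-2n-4})/(1+t²)` (from `x^k/k! ≤ eˣ`), integrable on `(0,∞)`.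

## E. Thm 1.8, necessity half (`det_zetaScrewHankel_nonneg_of_RH`)

Under RH `Ψ ≥ 0` (Thm 1.7, tree), so the Hankel forms `∑ᵢⱼ xᵢμ_{i+j}xⱼ = ∫ 4⁻¹e^{-t/2}Ψ(t)(∑xᵢtⁱ)²dt`
and `∑ᵢⱼ xᵢμ_{i+j+1}xⱼ = ∫ 4⁻¹e^{-t/2}Ψ(t)·t·(∑xᵢtⁱ)²dt` are non-negative (§D gives the
integrability needed to exchange sum and integral), the real symmetric matrices `Δ_n`, `Δ_n^{(1)}`
are positive semidefinite, and `Matrix.PosSemidef.det_nonneg` gives `det ≥ 0` — the printed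
"Stieltjes moment sequence ⟹ Hankel determinants `≥ 0` [KrNu77]" step, done by hand. The
sufficiency half of Thm 1.8 (moment determinacy [Lin17]) is not attempted; `Suzuki2023_thm18`
stays a named fact.

## F. (11.2) (`Suzuki2023_eq112_holds`)

"By (1.2) and a little calculation": with `W(u) = e^{-ωu}Ψ(u)` and `a = iz`, the three terms of
(11.1) have transforms `V := ∫₀^∞W(u)e^{au}du` (Thm 1.1 (1) at `a - ω`:
`ZetaScrewLaplace.integral_zetaScrew_mul_cexp`, needs `Im z > 1/2 - ω`), `2ω·(-1/a)·V` and
`ω²·a^{-2}·V` (Fubini on `(0,∞)²` for the running integrals `∫₀ᵗW` and `∫₀ᵗ(t-u)W(u)du`: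
`ZetaScrewShiftLaplace.integral_running_mul_cexp`, `integral_ramp_mul_cexp`, need `Im z > 0`),
and `V(1 - ω/a)² = V(a-ω)²/a²` with `V = (a-ω)^{-2}(ξ'/ξ)(1/2+ω-a)` gives `-z^{-2}(ξ'/ξ)(1/2+ω-iz)`.

## G. Thm 11.1, `⟸` (`Suzuki2023_thm111_mpr`, `riemannHypothesis_of_zetaScrew_eventually_nonneg`)

"From formula (11.2) and the fact that `ξ(s) ≠ 0` on the positive real line, if we use the same
result of Laplace transforms as in the proof of Theorem 1.7": with `g(x) = Ψ_ω(log x)` (eventually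
`≥ 0`), the Mellin transform converges absolutely on `Re s > max(1/2 - ω, 0)` and equals
`R_ω(s) = s^{-2}(ξ'/ξ)(1/2 + ω + s)` (§F); `R_ω` is holomorphic near every point of the real ray
`(0, ∞)` (no real zeros of `ξ`), so the tree's Landau lemma
(`Landau.integrableOn_of_differentiableOn_union_convex`, which allows `g ≥ 0` only beyond some
`X₁`) pushes the abscissa of convergence below every `ε > 0`; the identity theorem and the order
argument of §A then exclude zeros of `ξ(1/2 + ω + ·)` on `Re > 0`. At `ω = 0` this is the door
"`Ψ` eventually non-negative `⟹` RH", sharper than Thm 1.7's sufficiency half. The `⟹` direction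
of Thm 11.1 (Kreĭn–Langer) is not attempted: `Suzuki2023_thm111` stays a named fact.

## H. (1.15) (`zetaScrewMoment_eq_iteratedDeriv`)

`μ_n = R^{(n)}(0)`, `R(X) = (1-2X)^{-2}(ξ'/ξ)(1-X)`: on `Re X < 0`, `R(X) = 4^{-1}Φ(1/2 - X)` with `Φ`
the Laplace transform of `Ψ` (Thm 1.1 (1)), so `R^{(n)}(X) = 4^{-1}∫₀^∞Ψ(t)tⁿe^{-(1/2-X)t}dt`
(tree `Landau.iteratedDeriv_mellinIoi`); let `X → 0⁻`: the left side tends to `R^{(n)}(0)` (`R` is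
analytic at `0`), the right side to `μ_n` (dominated convergence, §D). The printed "expand
`exp(izt)` in powers of `X`" is not available unconditionally (the integral converges only for
`Re X ≤ 0`); the one-sided limit replaces it.

## I. Thm 8.1 ((8.1)–(8.2), (8.3)) and Thm 8.2 ((8.9), `b_{n,k} > 0`)
## (`Suzuki2023_thm81_holds`, `Suzuki2023_thm81_inv_holds`, `Suzuki2023_thm82_holds`)

The source obtains (8.2) and (8.3) "by different power series expansions of (8.4)"
(`∑ λ_{n+1}wⁿ = (1-w)^{-2}(ξ'/ξ)(1/(1-w))`): (8.2) from the expansion (8.5) of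
`(1+w)²(1-w)^{-4}exp(-t(1+w)/(2(1-w)))`, (8.3) from the zero sums `λ_n = ∑_ρ(1-(1-1/ρ)ⁿ)` and
(8.6)–(8.8). Here both are read off ONE expansion, that of `log ξ` at `s = 1`
(`e_j := (log ξ)^{(j)}(1)`), which is where (1.14) and (1.15) meet: Leibniz on Keiper's formula
`(n-1)!λ_n = dⁿ/dsⁿ[s^{n-1}log ξ(s)](1)` (the tree's DEFINITION of `keiperLiCoeff`) gives
`λ_n = ∑_j C(n,j) e_j/(j-1)!` (`ZetaScrewLiMoments.keiper_div_factorial_eq`); Leibniz on the PROVED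
(1.15) `μ_n = dⁿ/dXⁿ[(1-2X)^{-2}(ξ'/ξ)(1-X)](0)` (§H) gives `μ_n` in terms of the `e_j`
(`moment_eq_sum_e`, with `[(1-2X)^{-2}]^{(i)}(0) = (i+1)!2^i`) and, read backwards through the
polynomial `(1-2X)²`, `(-1)^k e_{k+1} = μ_k - 4kμ_{k-1} + 4k(k-1)μ_{k-2}` (`e_succ_eq`). Then (8.3) is
binomial inversion (`binomial_inversion`, the "inductive procedure" of (8.8)) plus one exchange of
sums, and (8.2) is a three-term regrouping (`sum_three_term_regroup`) plus the coefficient identity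
`[C(n,k+1) + 4C(n,k+2) + 4C(n,k+3)]/(k!n!) = [(k-(4n-1)/2)² + 2n + 7/4]/(k!(k+3)!(n-k-1)!)`
(`coeff_82`, "by elementary calculations"). The identities are proved over `ℂ` for the complex
numbers whose real parts define `λ_n`, and real parts are taken at the end (so no separate
"`λ_n` is real" lemma is needed). Thm 8.2: `b_{n,k} > 0` from `a_j ≥ 0` (tree:
`iteratedDeriv_liPhi_zero_nonneg xiTaylorCoeff_pos_holds`, Li's positivity) — in fact for all
`n, k`; the recurrence (8.9) exactly as printed: Li's recurrence (8.10), which the tree has as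
`Freitas2006_recurrence_holds` at `z₀ = 0` together with `Freitas2006_lemma_3_1_ii_holds` /
`freitasAlpha_one` (`d_m(0) = λ_{m+1}`, `a_j = 2c_j(0)`), then (8.2) for all `n ≥ 1` substituted on
both sides and the right-hand side grouped by the `μ_k` (`suzukiB_eq` is the bookkeeping identity
`b_{n,k} = n!(n+1)!c(n+1,k) + ∑_{j=k+1}^{n} n!j!c(j,k)a_{n-j+1}`, `c(m,k)` the coefficient of (8.2);
the leading term uses `n!(n+1)!c(n+1,n) = 1`).

Everything in this file is proved; there are no new definitions of notions and no named facts
(the hypothesis "`∫₀^∞ Ψ(t)e^{-σ't}dt` converges absolutely for every `σ' > 0`" is spelled out in each lemma).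

## References

* M. Suzuki, J. Lond. Math. Soc. (2) 108 (2023), no. 4, 1448–1487; arXiv:2206.03682, Thm 1.6,
  §7.1, remark after Thm 1.6 (p. 3), (1.13), Thm 1.8 / §7.3, §11 (11.1)–(11.2). [Suzuki2023]
* E. C. Titchmarsh, *The Theory of the Riemann Zeta-Function*, 2nd ed., §10.1 (`ξ` on the
  critical line; `ξ''(1/2) > 0`). [Titchmarsh1986]
* X.-J. Li, *The positivity of a sequence of numbers and the Riemann hypothesis*, J. Number Theory
  65 (1997) 325–333 ((1.1), the recurrence (8.10), `a_j > 0`). [Li1997]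
* P. Freitas, *A Li-type criterion for zero-free half-planes of Riemann's zeta function*,
  arXiv:math/0507368 (2006), §3 (recurr), Lemma 3.1 (ii) (the tree's form of (8.10)). [Freitas2006LiHalfPlanes]
-/

noncomputable section

open Complex Filter Topology Set MeasureTheory
open scoped Real Nat

namespace Literature.NumberTheory.LFunctions

namespace ZetaScrewGrowth

/-! ### A. The Laplace identity on the right half-plane under integrability -/

/-- Under `LaplaceIntegrable`, `F` is holomorphic on `Re s > ε` for every `ε > 0`
(`Landau.differentiableOn_mellinIoi_of_forall`). [cite: Suzuki2023, §7.1 (proof of Thm 1.6)] -/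
theorem differentiableOn_F (hS : ∀ σ' : ℝ, 0 < σ' → IntegrableOn (fun t : ℝ ↦ zetaScrew t * Real.exp (-σ' * t)) (Ioi 0)) {ε : ℝ} (hε : 0 < ε) :
    DifferentiableOn ℂ (Landau.mellinIoi (fun x ↦ zetaScrew (Real.log x))) {s : ℂ | ε < s.re} := by
  have hg : Measurable (fun x ↦ zetaScrew (Real.log x)) :=
    continuous_zetaScrew.measurable.comp Real.measurable_log
  refine Landau.differentiableOn_mellinIoi_of_forall hg fun σ' hσ' ↦ ?_
  exact (ZetaScrewLandau.integrableOn_zetaScrew_log_iff σ').2 (hS σ' (hε.trans hσ'))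

/-- **`F(s) s² ξ(1/2+s) = ξ'(1/2+s)` on `Re s > 0`** under `LaplaceIntegrable` (Thm 1.1 (1) on
`Re s > 1/2`, then the identity theorem on the half-plane `Re s > Re s₀/2`). [cite: Suzuki2023, §7.1 (proof of Thm 1.6)] -/
theorem F_mul_eq (hS : ∀ σ' : ℝ, 0 < σ' → IntegrableOn (fun t : ℝ ↦ zetaScrew t * Real.exp (-σ' * t)) (Ioi 0)) {s : ℂ} (hs : 0 < s.re) :
    Landau.mellinIoi (fun x ↦ zetaScrew (Real.log x)) s * s ^ 2 * riemannXi (1 / 2 + s) =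
      deriv riemannXi (1 / 2 + s) := by
  set ε : ℝ := s.re / 2 with hε_def
  have hε : 0 < ε := by positivity
  set H : Set ℂ := {s : ℂ | ε < s.re} with hH_def
  have hHo : IsOpen H := isOpen_lt continuous_const Complex.continuous_re
  have hHpre : IsPreconnected H := (convex_halfSpace_re_gt ε).isPreconnected
  have hFdiff : DifferentiableOn ℂ (Landau.mellinIoi (fun x ↦ zetaScrew (Real.log x))) H :=
    differentiableOn_F hS hε
  set Z : ℂ → ℂ := fun s ↦ riemannXi (1 / 2 + s) with hZ_def
  have hZd : Differentiable ℂ Z := differentiable_riemannXi.comp (by fun_prop)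
  have hZa : ∀ s, AnalyticAt ℂ Z s := fun s ↦ hZd.analyticAt s
  have hderivZ : ∀ s, deriv Z s = deriv riemannXi (1 / 2 + s) := fun s ↦ by
    simp only [hZ_def]
    exact deriv_comp_const_add riemannXi (1 / 2) s
  set G : ℂ → ℂ := fun s ↦ Landau.mellinIoi (fun x ↦ zetaScrew (Real.log x)) s * s ^ 2 with hG_def
  have hGa : ∀ s ∈ H, AnalyticAt ℂ G s := fun s hs ↦
    ((hFdiff.analyticOnNhd hHo) s hs).mul (analyticAt_id.pow 2)
  have hf₁ : AnalyticOnNhd ℂ (G * Z) H := fun s hs ↦ (hGa s hs).mul (hZa s)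
  have hf₂ : AnalyticOnNhd ℂ (deriv Z) H := fun s _ ↦ (hZa s).deriv
  -- a point of agreement: `s₀ = s.re + 2` (real part `> 1`)
  set s₀ : ℂ := ((s.re + 2 : ℝ) : ℂ) with hs₀_def
  have hs₀H : s₀ ∈ H := by
    simp only [hH_def, Set.mem_setOf_eq, hs₀_def, ofReal_re, hε_def]; linarith
  have hev : (G * Z) =ᶠ[𝓝 s₀] deriv Z := by
    have hopen : IsOpen {s : ℂ | 1 < s.re} := isOpen_lt continuous_const Complex.continuous_re
    have hs₀1 : s₀ ∈ {s : ℂ | 1 < s.re} := by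
      simp only [Set.mem_setOf_eq, hs₀_def, ofReal_re]; linarith
    filter_upwards [hopen.mem_nhds hs₀1] with u hu
    have hu' : 1 < u.re := hu
    have hξ : riemannXi (1 / 2 + u) ≠ 0 := riemannXi_ne_zero_of_one_le_re (by simp; linarith)
    have hu0 : u ≠ 0 := fun h ↦ by rw [h, zero_re] at hu'; linarith
    rw [Pi.mul_apply, hderivZ u]
    simp only [hG_def, hZ_def]
    rw [ZetaScrewLandau.mellinIoi_eq_of_re_gt (by linarith), logDeriv_apply]
    set A : ℂ := deriv riemannXi (1 / 2 + u)
    set B : ℂ := riemannXi (1 / 2 + u)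
    field_simp
  have hEqOn : EqOn (G * Z) (deriv Z) H :=
    hf₁.eqOn_of_preconnected_of_eventuallyEq hf₂ hHpre hs₀H hev
  have hsH : s ∈ H := by simp only [hH_def, Set.mem_setOf_eq, hε_def]; linarith
  have := hEqOn hsH
  rw [Pi.mul_apply, hderivZ s] at this
  simpa [hG_def, hZ_def] using this

/-- **No zeros of `ξ(1/2 + ·)` on `Re w > 0` under `LaplaceIntegrable`** ("`(ξ'/ξ)(1/2 - iz)` has
no poles in `ℂ₊`": at a zero, `ξ' = (F s²)·ξ` near it contradicts `ord ξ' + 1 = ord ξ`). [cite: Suzuki2023, §7.1 (proof of Thm 1.6)] -/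
theorem riemannXi_ne_zero_of_laplace (hS : ∀ σ' : ℝ, 0 < σ' → IntegrableOn (fun t : ℝ ↦ zetaScrew t * Real.exp (-σ' * t)) (Ioi 0)) {w₀ : ℂ} (hw₀ : 0 < w₀.re) :
    riemannXi (1 / 2 + w₀) ≠ 0 := by
  intro hzero
  set ε : ℝ := w₀.re / 2 with hε_def
  have hε : 0 < ε := by positivity
  set H : Set ℂ := {s : ℂ | ε < s.re} with hH_def
  have hHo : IsOpen H := isOpen_lt continuous_const Complex.continuous_re
  have hFdiff : DifferentiableOn ℂ (Landau.mellinIoi (fun x ↦ zetaScrew (Real.log x))) H :=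
    differentiableOn_F hS hε
  set Z : ℂ → ℂ := fun s ↦ riemannXi (1 / 2 + s) with hZ_def
  have hZd : Differentiable ℂ Z := differentiable_riemannXi.comp (by fun_prop)
  have hZa : ∀ s, AnalyticAt ℂ Z s := fun s ↦ hZd.analyticAt s
  have hderivZ : ∀ s, deriv Z s = deriv riemannXi (1 / 2 + s) := fun s ↦ by
    simp only [hZ_def]
    exact deriv_comp_const_add riemannXi (1 / 2) s
  set G : ℂ → ℂ := fun s ↦ Landau.mellinIoi (fun x ↦ zetaScrew (Real.log x)) s * s ^ 2 with hG_def
  have hGa : ∀ s ∈ H, AnalyticAt ℂ G s := fun s hs ↦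
    ((hFdiff.analyticOnNhd hHo) s hs).mul (analyticAt_id.pow 2)
  have hw₀H : w₀ ∈ H := by simp [hH_def, hε_def]; linarith
  have hev : deriv Z =ᶠ[𝓝 w₀] G * Z := by
    have hO : IsOpen {s : ℂ | 0 < s.re} := isOpen_lt continuous_const Complex.continuous_re
    filter_upwards [hO.mem_nhds (show w₀ ∈ {s : ℂ | 0 < s.re} from hw₀)] with s hs
    rw [Pi.mul_apply, hderivZ s]
    simp only [hG_def, hZ_def]
    exact (F_mul_eq hS hs).symm
  have hZ0 : Z w₀ = 0 := hzero
  have h1 : analyticOrderAt (deriv Z) w₀ + 1 = analyticOrderAt Z w₀ := by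
    have := (hZa w₀).analyticOrderAt_deriv_add_one
    simpa [hZ0] using this
  have h2 : analyticOrderAt (deriv Z) w₀ = analyticOrderAt G w₀ + analyticOrderAt Z w₀ := by
    rw [analyticOrderAt_congr hev, analyticOrderAt_mul (hGa w₀ hw₀H) (hZa w₀)]
  rw [h2] at h1
  generalize hoZ : analyticOrderAt Z w₀ = oZ at h1
  generalize hoG : analyticOrderAt G w₀ = oG at h1
  cases oZ with
  | top =>
    have hloc : ∀ᶠ s in 𝓝 w₀, Z s = 0 := analyticOrderAt_eq_top.1 hoZ
    have hall : EqOn Z 0 univ :=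
      (hZd.differentiableOn.analyticOnNhd isOpen_univ).eqOn_zero_of_preconnected_of_eventuallyEq_zero
        isPreconnected_univ (Set.mem_univ w₀) hloc
    have h1' : Z 1 = 0 := hall (Set.mem_univ 1)
    simp only [hZ_def] at h1'
    exact riemannXi_ne_zero_of_one_le_re (s := 1 / 2 + 1) (by norm_num) h1'
  | coe n =>
    cases oG with
    | top => simp at h1
    | coe m =>
      have h' : (m + n + 1 : ℕ) = n := by exact_mod_cast h1
      omega

/-- **RH under `LaplaceIntegrable`** (no zeros of `ζ` with `1/2 < Re s < 1`, then the functional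
equation `quasiRiemannHypothesis_one_half_iff_holds`). [cite: Suzuki2023, §7.1 (proof of Thm 1.6)] -/
theorem riemannHypothesis_of_laplace (hS : ∀ σ' : ℝ, 0 < σ' → IntegrableOn (fun t : ℝ ↦ zetaScrew t * Real.exp (-σ' * t)) (Ioi 0)) : RiemannHypothesis := by
  refine quasiRiemannHypothesis_one_half_iff_holds.1 fun s hs h1 h2 ↦ ?_
  have hξ : riemannXi s = 0 := (riemannXi_eq_zero_iff_holds s).2 ⟨hs, by linarith, h2⟩
  have hw : 0 < (s - 1 / 2).re := by simp; linarith
  refine riemannXi_ne_zero_of_laplace hS hw ?_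
  rw [show (1 / 2 : ℂ) + (s - 1 / 2) = s by ring]
  exact hξ

/-! ### B. Thm 1.6 -/

/-- A bounded `Ψ` has absolutely convergent Laplace integrals for every `σ' > 0` ("the integral on
the left-hand side of (1.2) converges absolutely"). [cite: Suzuki2023, §7.1 (proof of Thm 1.6)] -/
theorem laplaceIntegrable_of_bounded (hM : ∃ M : ℝ, ∀ t : ℝ, 0 ≤ t → |zetaScrew t| ≤ M) :
    ∀ σ' : ℝ, 0 < σ' → IntegrableOn (fun t : ℝ ↦ zetaScrew t * Real.exp (-σ' * t)) (Ioi 0) := by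
  obtain ⟨M, hM⟩ := hM
  intro σ' hσ'
  have hmeas : AEStronglyMeasurable (fun t : ℝ ↦ zetaScrew t * Real.exp (-σ' * t))
      (volume.restrict (Ioi 0)) :=
    (continuous_zetaScrew.mul (Real.continuous_exp.comp (continuous_const.mul continuous_id))).aestronglyMeasurable
  refine Integrable.mono' ((exp_neg_integrableOn_Ioi 0 hσ').const_mul M) hmeas ?_
  refine (ae_restrict_mem measurableSet_Ioi).mono fun t ht ↦ ?_
  have ht' : 0 ≤ t := le_of_lt ht
  rw [Real.norm_eq_abs, abs_mul, abs_of_pos (Real.exp_pos _)]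
  exact mul_le_mul_of_nonneg_right (hM t ht') (Real.exp_pos _).le

/-- `∑_ρ 2 m(ρ)/γ²` converges (`γ = Im ρ`, `|γ| > 14`, so `|ρ|² ≤ 2γ²`; comparison with the tree's
`∑ m(ρ)/|ρ|² < ∞`, `FordL33.summable_order_div_norm_sq`) — "`ξ(1/2 - iz)` is an entire function
of order one, `∑_γ |γ|^{-2} < ∞`". [cite: Suzuki2023, §7.1 (proof of Thm 1.6)] -/
theorem summable_two_mul_order_div_im_sq :
    Summable fun ρ : ZetaZeros.riemannZetaNontrivialZeros ↦
      2 * (riemannZetaZeroOrder (ρ : ℂ) : ℝ) / (ρ : ℂ).im ^ 2 := by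
  have hS := FordL33.summable_order_div_norm_sq
  refine (hS.mul_left 4).of_nonneg_of_le (fun ρ ↦ ?_) fun ρ ↦ ?_
  · have hm := FordL33.order_pos ρ
    positivity
  · have hm := FordL33.order_pos ρ
    have him : 14 < |(ρ : ℂ).im| := FordL33.fourteen_lt_abs_im ρ
    have hre0 := ZetaZeros.riemannZetaNontrivialZeros.re_pos ρ.2
    have hre1 := ZetaZeros.riemannZetaNontrivialZeros.re_lt_one ρ.2
    have hnorm : ‖(ρ : ℂ)‖ ^ 2 = (ρ : ℂ).re ^ 2 + (ρ : ℂ).im ^ 2 := by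
      rw [← Complex.normSq_eq_norm_sq, Complex.normSq_apply]; ring
    have him2 : 14 ^ 2 < (ρ : ℂ).im ^ 2 := by
      have := sq_lt_sq' (by linarith [abs_nonneg ((ρ : ℂ).im)]) him
      simpa [sq_abs] using this
    have hre2 : (ρ : ℂ).re ^ 2 < 1 := by nlinarith
    have hpos : 0 < (ρ : ℂ).im ^ 2 := by linarith
    have hnpos : 0 < ‖(ρ : ℂ)‖ ^ 2 := by rw [hnorm]; positivity
    -- `‖ρ‖² ≤ 2 γ²`
    have hle : ‖(ρ : ℂ)‖ ^ 2 ≤ 2 * (ρ : ℂ).im ^ 2 := by rw [hnorm]; linarith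
    rw [show 4 * ((riemannZetaZeroOrder (ρ : ℂ) : ℝ) / ‖(ρ : ℂ)‖ ^ 2) =
      2 * (riemannZetaZeroOrder (ρ : ℂ) : ℝ) * (2 / ‖(ρ : ℂ)‖ ^ 2) by ring,
      show 2 * (riemannZetaZeroOrder (ρ : ℂ) : ℝ) / (ρ : ℂ).im ^ 2 =
      2 * (riemannZetaZeroOrder (ρ : ℂ) : ℝ) * (1 / (ρ : ℂ).im ^ 2) by ring]
    refine mul_le_mul_of_nonneg_left ?_ (by positivity)
    rw [div_le_div_iff₀ hpos hnpos]
    linarith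

/-- **RH ⇒ `|Ψ(t)| ≤ 2∑_γ m(γ)/γ²` for every real `t`** (Suzuki2023 §7.1, first paragraph; also
the bound "`sup Ψ ≤ 2∑_γ γ^{-2}`" quoted after the proof). [cite: Suzuki2023, §7.1 (proof of Thm 1.6)] -/
theorem abs_zetaScrew_le_of_RH (hRH : RiemannHypothesis) (t : ℝ) :
    |zetaScrew t| ≤ ∑' ρ : ZetaZeros.riemannZetaNontrivialZeros,
      2 * (riemannZetaZeroOrder (ρ : ℂ) : ℝ) / (ρ : ℂ).im ^ 2 := by
  rw [abs_of_nonneg (ZetaScrewThm17.zetaScrew_nonneg_of_RH hRH t)]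
  refine hasSum_le (fun ρ ↦ ?_) (ZetaScrewThm17.hasSum_real hRH t)
    summable_two_mul_order_div_im_sq.hasSum
  have hm := FordL33.order_pos ρ
  have hcos : 1 - Real.cos ((ρ : ℂ).im * t) ≤ 2 := by linarith [Real.neg_one_le_cos ((ρ : ℂ).im * t)]
  have hpos : 0 < (ρ : ℂ).im ^ 2 := by
    have := ZetaZeros.riemannZetaNontrivialZeros.im_ne_zero ρ.2
    positivity
  have h := mul_le_mul_of_nonneg_left (div_le_div_of_nonneg_right hcos hpos.le) hm.le
  calc (riemannZetaZeroOrder (ρ : ℂ) : ℝ) * ((1 - Real.cos ((ρ : ℂ).im * t)) / (ρ : ℂ).im ^ 2)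
      ≤ (riemannZetaZeroOrder (ρ : ℂ) : ℝ) * (2 / (ρ : ℂ).im ^ 2) := h
    _ = 2 * (riemannZetaZeroOrder (ρ : ℂ) : ℝ) / (ρ : ℂ).im ^ 2 := by ring

/-- **Suzuki2023 Thm 1.6** as a theorem: RH iff `Ψ` is bounded on `[0, ∞)`. [cite: Suzuki2023, Thm 1.6] -/
theorem riemannHypothesis_iff_zetaScrew_bounded :
    RiemannHypothesis ↔ ∃ M : ℝ, ∀ t : ℝ, 0 ≤ t → |zetaScrew t| ≤ M :=
  ⟨fun hRH ↦ ⟨_, fun t _ ↦ abs_zetaScrew_le_of_RH hRH t⟩,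
    fun hM ↦ riemannHypothesis_of_laplace (laplaceIntegrable_of_bounded hM)⟩

/-! ### C. `Ψ ∉ L¹(0,∞)` and `Ψ ∉ L²(0,∞)` -/

/-- `ξ'(1/2) = 0` (differentiate the functional equation `ξ(1 - s) = ξ(s)` at `s = 1/2`). [cite: Titchmarsh1986, §2.1 (functional equation of `ξ`)] -/
theorem deriv_riemannXi_one_half : deriv riemannXi (1 / 2) = 0 := by
  have h : deriv (fun s : ℂ ↦ riemannXi (1 - s)) (1 / 2) = -deriv riemannXi (1 - 1 / 2) :=
    deriv_comp_const_sub riemannXi 1 (1 / 2)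
  have hfun : (fun s : ℂ ↦ riemannXi (1 - s)) = riemannXi := funext riemannXi_one_sub
  rw [hfun, show (1 : ℂ) - 1 / 2 = 1 / 2 by norm_num] at h
  linear_combination (1 / 2 : ℂ) * h

/-- `ξ''(1/2) ≠ 0` (indeed `> 0`: the tree's `iteratedDeriv_two_mul_riemannXi_half_pos`, i.e. the
"simple pole at `z = 0`" of `-z^{-2}(ξ'/ξ)(1/2 - iz)` in the source). [cite: Suzuki2023, p. 3, remark after Thm 1.6] -/
theorem deriv_deriv_riemannXi_one_half_ne_zero : deriv (deriv riemannXi) (1 / 2) ≠ 0 := by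
  have h := (iteratedDeriv_two_mul_riemannXi_half_pos 1).1
  rw [show 2 * 1 = 1 + 1 from rfl, iteratedDeriv_succ, iteratedDeriv_one] at h
  intro h0
  rw [h0] at h
  simp at h

/-- `ξ'(1/2 + y)/y → ξ''(1/2)` as `y → 0⁺` along the reals (`ξ'(1/2) = 0`). [cite: Suzuki2023, p. 3, remark after Thm 1.6] -/
theorem tendsto_deriv_riemannXi_div :
    Tendsto (fun y : ℝ ↦ deriv riemannXi (1 / 2 + y) / (y : ℂ)) (𝓝[>] 0)
      (𝓝 (deriv (deriv riemannXi) (1 / 2))) := by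
  have hA : AnalyticAt ℂ (deriv riemannXi) (1 / 2) := (differentiable_riemannXi.analyticAt _).deriv
  have hd : HasDerivAt (deriv riemannXi) (deriv (deriv riemannXi) (1 / 2)) (1 / 2) :=
    hA.differentiableAt.hasDerivAt
  rw [hasDerivAt_iff_tendsto_slope_zero] at hd
  have hof : Tendsto (fun y : ℝ ↦ (y : ℂ)) (𝓝[>] 0) (𝓝[≠] 0) := by
    refine tendsto_nhdsWithin_of_tendsto_nhds_of_eventually_within _ ?_ ?_
    · have : Tendsto (fun y : ℝ ↦ (y : ℂ)) (𝓝 0) (𝓝 ((0 : ℝ) : ℂ)) :=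
        Complex.continuous_ofReal.tendsto 0
      rw [Complex.ofReal_zero] at this
      exact this.mono_left nhdsWithin_le_nhds
    · filter_upwards [self_mem_nhdsWithin] with y hy
      simpa using ne_of_gt hy
  refine (hd.comp hof).congr' ?_
  filter_upwards with y
  simp only [Function.comp_apply, deriv_riemannXi_one_half, sub_zero, smul_eq_mul]
  ring

/-- `‖F(y)‖ ≤ ∫₀^∞ |Ψ(t)| e^{-yt} dt` for real `y`. [cite: Suzuki2023, p. 3, remark after Thm 1.6] -/
theorem norm_F_le (y : ℝ) :
    ‖Landau.mellinIoi (fun x ↦ zetaScrew (Real.log x)) (y : ℂ)‖ ≤ ∫ t in Ioi (0 : ℝ), |zetaScrew t| * Real.exp (-y * t) := by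
  rw [ZetaScrewLandau.mellinIoi_zetaScrew_log]
  refine (norm_integral_le_integral_norm _).trans (le_of_eq ?_)
  refine setIntegral_congr_fun measurableSet_Ioi fun t _ ↦ ?_
  rw [norm_mul, Complex.norm_real, Real.norm_eq_abs, ZetaScrewLaplace.norm_cexp_mul_ofReal]
  simp

/-- The contradiction: under `LaplaceIntegrable` the transform cannot be `O(y^{-1/2})` as
`y → 0⁺` (in particular not bounded), because `ξ'(1/2 + y) = F(y) y² ξ(1/2 + y)` would force
`ξ''(1/2) = 0` ("it contradicts `z = 0` being a simple pole of the right-hand side"). [cite: Suzuki2023, p. 3, remark after Thm 1.6] -/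
theorem false_of_laplace_bound (hS : ∀ σ' : ℝ, 0 < σ' → IntegrableOn (fun t : ℝ ↦ zetaScrew t * Real.exp (-σ' * t)) (Ioi 0))
    (hB : ∃ C : ℝ, ∀ y : ℝ, 0 < y → y < 1 →
      ‖Landau.mellinIoi (fun x ↦ zetaScrew (Real.log x)) (y : ℂ)‖ ≤ C / Real.sqrt y) :
    False := by
  obtain ⟨C, hC⟩ := hB
  have hid : ∀ y : ℝ, 0 < y →
      deriv riemannXi (1 / 2 + y) =
        Landau.mellinIoi (fun x ↦ zetaScrew (Real.log x)) y * (y : ℂ) ^ 2 * riemannXi (1 / 2 + y) :=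
    fun y hy ↦ (F_mul_eq hS (s := (y : ℂ)) (by simpa using hy)).symm
  have h1 := tendsto_deriv_riemannXi_div
  have h2 : Tendsto (fun y : ℝ ↦ deriv riemannXi (1 / 2 + y) / (y : ℂ)) (𝓝[>] 0) (𝓝 0) := by
    have hbound : ∀ y : ℝ, 0 < y → y < 1 →
        ‖deriv riemannXi (1 / 2 + y) / (y : ℂ)‖ ≤ C * Real.sqrt y * ‖riemannXi (1 / 2 + y)‖ := by
      intro y hy hy1
      have hF := hC y hy hy1
      have hsqpos : 0 < Real.sqrt y := Real.sqrt_pos.2 hy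
      have hsq : Real.sqrt y ^ 2 = y := Real.sq_sqrt hy.le
      rw [hid y hy, norm_div, norm_mul, norm_mul, norm_pow, Complex.norm_real, Real.norm_eq_abs,
        abs_of_pos hy, div_le_iff₀ hy]
      have hFy : ‖Landau.mellinIoi (fun x ↦ zetaScrew (Real.log x)) (y : ℂ)‖ * y ^ 2 ≤
          C * Real.sqrt y * y := by
        calc ‖Landau.mellinIoi (fun x ↦ zetaScrew (Real.log x)) (y : ℂ)‖ * y ^ 2
            ≤ C / Real.sqrt y * y ^ 2 :=
              mul_le_mul_of_nonneg_right hF (by positivity)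
          _ = C * Real.sqrt y * y := by
              field_simp
              rw [hsq]
      calc ‖Landau.mellinIoi (fun x ↦ zetaScrew (Real.log x)) (y : ℂ)‖ * y ^ 2 * ‖riemannXi (1 / 2 + y)‖
          ≤ C * Real.sqrt y * y * ‖riemannXi (1 / 2 + y)‖ :=
            mul_le_mul_of_nonneg_right hFy (norm_nonneg _)
        _ = C * Real.sqrt y * ‖riemannXi (1 / 2 + y)‖ * y := by ring
    have hmaj : Tendsto (fun y : ℝ ↦ C * Real.sqrt y * ‖riemannXi (1 / 2 + y)‖) (𝓝[>] 0) (𝓝 0) := by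
      have hs : Tendsto (fun y : ℝ ↦ Real.sqrt y) (𝓝[>] 0) (𝓝 0) := by
        have := Real.continuous_sqrt.tendsto 0
        rw [Real.sqrt_zero] at this
        exact this.mono_left nhdsWithin_le_nhds
      have hξ : Tendsto (fun y : ℝ ↦ ‖riemannXi (1 / 2 + y)‖) (𝓝[>] 0)
          (𝓝 ‖riemannXi (1 / 2 + ((0 : ℝ) : ℂ))‖) := by
        have hc : Continuous (fun y : ℝ ↦ ‖riemannXi (1 / 2 + y)‖) :=
          (differentiable_riemannXi.continuous.comp (by fun_prop)).norm
        exact (hc.tendsto 0).mono_left nhdsWithin_le_nhds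
      have := (hs.const_mul C).mul hξ
      simpa using this
    refine squeeze_zero_norm' ?_ hmaj
    filter_upwards [Ioo_mem_nhdsGT (zero_lt_one' ℝ)] with y hy
    exact hbound y hy.1 hy.2
  exact deriv_deriv_riemannXi_one_half_ne_zero (tendsto_nhds_unique h1 h2)

/-- **`Ψ ∉ L¹(0, ∞)`** (unconditionally). [cite: Suzuki2023, p. 3, remark after Thm 1.6] -/
theorem not_integrableOn_zetaScrew : ¬ IntegrableOn zetaScrew (Ioi 0) := by
  intro hL1
  have hmeas : ∀ y : ℝ, AEStronglyMeasurable (fun t : ℝ ↦ zetaScrew t * Real.exp (-y * t))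
      (volume.restrict (Ioi 0)) := fun y ↦
    (continuous_zetaScrew.mul (Real.continuous_exp.comp (continuous_const.mul continuous_id))).aestronglyMeasurable
  -- Laplace integrability: `|Ψ e^{-σ't}| ≤ |Ψ|`
  have hdom : ∀ y : ℝ, 0 < y → ∀ t ∈ Ioi (0 : ℝ), |zetaScrew t| * Real.exp (-y * t) ≤ |zetaScrew t| := by
    intro y hy t ht
    have ht' : 0 < t := ht
    have : Real.exp (-y * t) ≤ 1 := Real.exp_le_one_iff.2 (by nlinarith)
    exact mul_le_of_le_one_right (abs_nonneg _) this
  have hS : ∀ σ' : ℝ, 0 < σ' → IntegrableOn (fun t : ℝ ↦ zetaScrew t * Real.exp (-σ' * t)) (Ioi 0) := by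
    intro y hy
    refine Integrable.mono' hL1.norm (hmeas y) ?_
    refine (ae_restrict_mem measurableSet_Ioi).mono fun t ht ↦ ?_
    rw [Real.norm_eq_abs, abs_mul, abs_of_pos (Real.exp_pos _), Real.norm_eq_abs]
    exact hdom y hy t ht
  refine false_of_laplace_bound hS ⟨∫ t in Ioi (0 : ℝ), |zetaScrew t|, fun y hy hy1 ↦ ?_⟩
  have hI : ∫ t in Ioi (0 : ℝ), |zetaScrew t| * Real.exp (-y * t) ≤ ∫ t in Ioi (0 : ℝ), |zetaScrew t| := by
    refine setIntegral_mono_on ?_ hL1.norm measurableSet_Ioi (hdom y hy)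
    have := (hS y hy).norm
    refine this.congr ?_
    refine (ae_restrict_mem measurableSet_Ioi).mono fun t _ ↦ ?_
    dsimp only
    rw [Real.norm_eq_abs, abs_mul, abs_of_pos (Real.exp_pos _)]
  have h0 : 0 ≤ ∫ t in Ioi (0 : ℝ), |zetaScrew t| :=
    setIntegral_nonneg measurableSet_Ioi fun t _ ↦ abs_nonneg _
  have hsq1 : Real.sqrt y ≤ 1 := Real.sqrt_le_one.mpr hy1.le
  have hsqpos : 0 < Real.sqrt y := Real.sqrt_pos.2 hy
  calc ‖Landau.mellinIoi (fun x ↦ zetaScrew (Real.log x)) (y : ℂ)‖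
      ≤ ∫ t in Ioi (0 : ℝ), |zetaScrew t| * Real.exp (-y * t) := norm_F_le y
    _ ≤ ∫ t in Ioi (0 : ℝ), |zetaScrew t| := hI
    _ ≤ (∫ t in Ioi (0 : ℝ), |zetaScrew t|) / Real.sqrt y := by
        rw [le_div_iff₀ hsqpos]
        exact mul_le_of_le_one_right h0 hsq1

/-- The elementary inequality `|a|e ≤ (a²/c + c e²)/2` (`c > 0`). [folklore] -/
private theorem two_mul_abs_mul_le {a e c : ℝ} (hc : 0 < c) : |a| * e ≤ (a ^ 2 / c + c * e ^ 2) / 2 := by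
  rw [le_div_iff₀ (by norm_num : (0 : ℝ) < 2), div_add' _ _ _ hc.ne', le_div_iff₀ hc]
  nlinarith [sq_nonneg (|a| - c * e), sq_abs a]

/-- **`Ψ ∉ L²(0, ∞)`** (unconditionally; weighted AM–GM `2|Ψ|e^{-yt} ≤ Ψ²/√y + √y e^{-2yt}`
gives `‖F(y)‖ ≤ (2‖Ψ‖₂² + 1)/(4√y)`). [cite: Suzuki2023, p. 3, remark after Thm 1.6] -/
theorem not_memLp_two_zetaScrew : ¬ MemLp zetaScrew 2 (volume.restrict (Ioi (0 : ℝ))) := by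
  intro hL2
  have hsq : IntegrableOn (fun t : ℝ ↦ zetaScrew t ^ 2) (Ioi 0) :=
    (memLp_two_iff_integrable_sq continuous_zetaScrew.aestronglyMeasurable).1 hL2
  set S : ℝ := ∫ t in Ioi (0 : ℝ), zetaScrew t ^ 2 with hS_def
  have hS0 : 0 ≤ S := setIntegral_nonneg measurableSet_Ioi fun t _ ↦ sq_nonneg _
  have hmeas : ∀ y : ℝ, AEStronglyMeasurable (fun t : ℝ ↦ zetaScrew t * Real.exp (-y * t))
      (volume.restrict (Ioi 0)) := fun y ↦
    (continuous_zetaScrew.mul (Real.continuous_exp.comp (continuous_const.mul continuous_id))).aestronglyMeasurable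
  -- the majorant `(Ψ²/c + c e^{-2yt})/2` and its integral
  have hexp2 : ∀ y : ℝ, 0 < y → ∀ t : ℝ, Real.exp (-y * t) ^ 2 = Real.exp (-(2 * y) * t) := by
    intro y _ t; rw [← Real.exp_nat_mul]; congr 1; push_cast; ring
  have hmajint : ∀ y c : ℝ, 0 < y → 0 < c →
      IntegrableOn (fun t : ℝ ↦ (zetaScrew t ^ 2 / c + c * Real.exp (-y * t) ^ 2) / 2) (Ioi 0) := by
    intro y c hy hc
    have h2 : IntegrableOn (fun t : ℝ ↦ Real.exp (-(2 * y) * t)) (Ioi 0) :=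
      exp_neg_integrableOn_Ioi 0 (by linarith)
    have := ((hsq.div_const c).add ((h2.congr_fun (fun t _ ↦ (hexp2 y hy t).symm)
      measurableSet_Ioi).const_mul c)).div_const 2
    exact this
  have hdom : ∀ y c : ℝ, 0 < y → 0 < c → IntegrableOn (fun t : ℝ ↦ zetaScrew t * Real.exp (-y * t)) (Ioi 0) ∧
      ∫ t in Ioi (0 : ℝ), |zetaScrew t| * Real.exp (-y * t) ≤ (S / c + c * (1 / (2 * y))) / 2 := by
    intro y c hy hc
    have hpt : ∀ t : ℝ, |zetaScrew t| * Real.exp (-y * t) ≤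
        (zetaScrew t ^ 2 / c + c * Real.exp (-y * t) ^ 2) / 2 := fun t ↦ two_mul_abs_mul_le hc
    have hint : IntegrableOn (fun t : ℝ ↦ zetaScrew t * Real.exp (-y * t)) (Ioi 0) := by
      refine Integrable.mono' (hmajint y c hy hc) (hmeas y) ?_
      refine (ae_restrict_mem measurableSet_Ioi).mono fun t _ ↦ ?_
      rw [Real.norm_eq_abs, abs_mul, abs_of_pos (Real.exp_pos _)]
      exact hpt t
    refine ⟨hint, ?_⟩
    have hnorm : IntegrableOn (fun t : ℝ ↦ |zetaScrew t| * Real.exp (-y * t)) (Ioi 0) := by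
      refine hint.norm.congr ?_
      refine (ae_restrict_mem measurableSet_Ioi).mono fun t _ ↦ ?_
      dsimp only
      rw [Real.norm_eq_abs, abs_mul, abs_of_pos (Real.exp_pos _)]
    calc ∫ t in Ioi (0 : ℝ), |zetaScrew t| * Real.exp (-y * t)
        ≤ ∫ t in Ioi (0 : ℝ), (zetaScrew t ^ 2 / c + c * Real.exp (-y * t) ^ 2) / 2 :=
          setIntegral_mono_on hnorm (hmajint y c hy hc) measurableSet_Ioi fun t _ ↦ hpt t
      _ = (S / c + c * (1 / (2 * y))) / 2 := by
          have h2 : IntegrableOn (fun t : ℝ ↦ Real.exp (-(2 * y) * t)) (Ioi 0) :=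
            exp_neg_integrableOn_Ioi 0 (by linarith)
          have h2' : IntegrableOn (fun t : ℝ ↦ Real.exp (-y * t) ^ 2) (Ioi 0) :=
            h2.congr_fun (fun t _ ↦ (hexp2 y hy t).symm) measurableSet_Ioi
          have hval : ∫ t in Ioi (0 : ℝ), Real.exp (-y * t) ^ 2 = 1 / (2 * y) := by
            rw [setIntegral_congr_fun measurableSet_Ioi (fun t _ ↦ hexp2 y hy t),
              integral_exp_mul_Ioi (by linarith) 0]
            simp only [mul_zero, Real.exp_zero]
            field_simp
          rw [integral_div, integral_add (hsq.div_const c) (h2'.const_mul c), integral_div,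
            integral_const_mul, hval]
  have hLap : ∀ σ' : ℝ, 0 < σ' → IntegrableOn (fun t : ℝ ↦ zetaScrew t * Real.exp (-σ' * t)) (Ioi 0) :=
    fun y hy ↦ (hdom y 1 hy one_pos).1
  refine false_of_laplace_bound hLap ⟨(2 * S + 1) / 4, fun y hy hy1 ↦ ?_⟩
  have hsqpos : 0 < Real.sqrt y := Real.sqrt_pos.2 hy
  have hsq : Real.sqrt y ^ 2 = y := Real.sq_sqrt hy.le
  have hb := (hdom y (Real.sqrt y) hy hsqpos).2
  calc ‖Landau.mellinIoi (fun x ↦ zetaScrew (Real.log x)) (y : ℂ)‖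
      ≤ ∫ t in Ioi (0 : ℝ), |zetaScrew t| * Real.exp (-y * t) := norm_F_le y
    _ ≤ (S / Real.sqrt y + Real.sqrt y * (1 / (2 * y))) / 2 := hb
    _ = (2 * S + 1) / 4 / Real.sqrt y := by
        field_simp
        rw [show (4 : ℝ) = 2 * 2 by norm_num]
        nlinarith [hsq]

/-- The remark after Thm 1.6 as a theorem: `Ψ ∉ L¹(0,∞)` and `Ψ ∉ L²(0,∞)`. [cite: Suzuki2023, p. 3, remark after Thm 1.6] -/
theorem zetaScrew_not_integrableOn_and_not_memLp :
    ¬ IntegrableOn zetaScrew (Ioi 0) ∧ ¬ MemLp zetaScrew 2 (volume.restrict (Ioi (0 : ℝ))) :=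
  ⟨not_integrableOn_zetaScrew, not_memLp_two_zetaScrew⟩

/-! ### D. The moments `μ_n` converge absolutely (Suzuki2023 (1.13), "by Theorem 1.1 (3)") -/

/-- `e^{-x} ≤ k!/x^k` for `x > 0`. [folklore] -/
private theorem exp_neg_le_factorial_div_pow {x : ℝ} (hx : 0 < x) (k : ℕ) :
    Real.exp (-x) ≤ (k ! : ℝ) / x ^ k := by
  have h := Real.pow_div_factorial_le_exp x hx.le k
  have hk : (0 : ℝ) < k ! := by exact_mod_cast Nat.factorial_pos k
  rw [div_le_iff₀ hk] at h
  rw [Real.exp_neg, inv_eq_one_div, div_le_div_iff₀ (Real.exp_pos _) (pow_pos hx k)]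
  linarith

/-- `tⁿ e^{-c√t} ≤ (2n+4)! c^{-(2n+4)} t^{-2}` for `t > 0`. [folklore] -/
private theorem pow_mul_exp_neg_sqrt_le (n : ℕ) {c : ℝ} (hc : 0 < c) {t : ℝ} (ht : 0 < t) :
    t ^ n * Real.exp (-(c * Real.sqrt t)) ≤ ((2 * n + 4)! : ℝ) / c ^ (2 * n + 4) / t ^ 2 := by
  have hx : 0 < c * Real.sqrt t := mul_pos hc (Real.sqrt_pos.2 ht)
  have h := exp_neg_le_factorial_div_pow hx (2 * n + 4)
  have hsq : Real.sqrt t ^ (2 * n + 4) = t ^ (n + 2) := by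
    rw [show 2 * n + 4 = 2 * (n + 2) by ring, pow_mul, Real.sq_sqrt ht.le]
  rw [mul_pow, hsq] at h
  calc t ^ n * Real.exp (-(c * Real.sqrt t))
      ≤ t ^ n * (((2 * n + 4)! : ℝ) / (c ^ (2 * n + 4) * t ^ (n + 2))) :=
        mul_le_mul_of_nonneg_left h (by positivity)
    _ = ((2 * n + 4)! : ℝ) / c ^ (2 * n + 4) / t ^ 2 := by
        field_simp
        ring

/-- `tⁿ e^{-c√t} ≤ 2 max(1, K)/(1 + t²)` on `(0, ∞)`, `K = (2n+4)!/c^{2n+4}`. [folklore] -/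
private theorem pow_mul_exp_neg_sqrt_le_inv_one_add_sq (n : ℕ) {c : ℝ} (hc : 0 < c) {t : ℝ} (ht : 0 < t) :
    t ^ n * Real.exp (-(c * Real.sqrt t)) ≤
      2 * max 1 (((2 * n + 4)! : ℝ) / c ^ (2 * n + 4)) * (1 + t ^ 2)⁻¹ := by
  set K : ℝ := ((2 * n + 4)! : ℝ) / c ^ (2 * n + 4) with hK
  have hK0 : 0 ≤ K := by positivity
  have hmax1 : 1 ≤ max 1 K := le_max_left _ _
  have hmaxK : K ≤ max 1 K := le_max_right _ _
  have h1t : 0 < 1 + t ^ 2 := by positivity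
  rw [← div_eq_mul_inv, le_div_iff₀ h1t]
  rcases le_or_gt 1 t with h1 | h1
  · -- `t ≥ 1`: use the factorial bound
    have h := pow_mul_exp_neg_sqrt_le n hc ht
    have ht2 : 1 ≤ t ^ 2 := one_le_pow₀ h1
    have hpos : 0 < t ^ 2 := by positivity
    calc t ^ n * Real.exp (-(c * Real.sqrt t)) * (1 + t ^ 2)
        ≤ K / t ^ 2 * (1 + t ^ 2) := mul_le_mul_of_nonneg_right h h1t.le
      _ = K * ((1 + t ^ 2) / t ^ 2) := by ring
      _ ≤ K * 2 := by
          refine mul_le_mul_of_nonneg_left ?_ hK0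
          rw [div_le_iff₀ hpos]; linarith
      _ ≤ 2 * max 1 K := by linarith [mul_le_mul_of_nonneg_left hmaxK (by norm_num : (0:ℝ) ≤ 2)]
  · -- `t < 1`: `tⁿ e^{-c√t} ≤ 1`
    have hpow : t ^ n ≤ 1 := pow_le_one₀ ht.le h1.le
    have hexp : Real.exp (-(c * Real.sqrt t)) ≤ 1 :=
      Real.exp_le_one_iff.2 (by have := mul_pos hc (Real.sqrt_pos.2 ht); linarith)
    have ht2 : t ^ 2 ≤ 1 := pow_le_one₀ ht.le h1.le
    calc t ^ n * Real.exp (-(c * Real.sqrt t)) * (1 + t ^ 2)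
        ≤ 1 * 1 * (1 + 1) := by
          gcongr
      _ ≤ 2 * max 1 K := by linarith

/-- **The integrand of `μ_n` is integrable on `(0, ∞)`** (Suzuki2023 after (1.13): "the integral is
absolutely convergent by Theorem 1.1 (3)"; here from `Suzuki2023_thm11_growth_holds`,
`|Ψ(t)| ≤ M e^{t/2 - c√t}`). [cite: Suzuki2023, (1.13), p. 3] -/
theorem integrableOn_moment_integrand (n : ℕ) :
    IntegrableOn (fun t : ℝ ↦ 4⁻¹ * Real.exp (-(t / 2)) * zetaScrew t * t ^ n) (Ioi 0) := by
  obtain ⟨c, hc, M, hM⟩ := Suzuki2023_thm11_growth_holds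
  have hM0 : 0 ≤ M := by
    have h := hM 1 one_pos
    have := abs_nonneg (zetaScrew 1)
    nlinarith [Real.exp_pos (1 / 2 - c * Real.sqrt 1)]
  set K : ℝ := ((2 * n + 4)! : ℝ) / c ^ (2 * n + 4)
  have hmeas : AEStronglyMeasurable (fun t : ℝ ↦ 4⁻¹ * Real.exp (-(t / 2)) * zetaScrew t * t ^ n)
      (volume.restrict (Ioi 0)) := by
    refine (Continuous.aestronglyMeasurable ?_)
    exact ((continuous_const.mul (Real.continuous_exp.comp (by fun_prop))).mul
      continuous_zetaScrew).mul (continuous_pow n)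
  refine Integrable.mono'
    ((integrable_inv_one_add_sq.const_mul (4⁻¹ * M * (2 * max 1 K))).integrableOn) hmeas ?_
  refine (ae_restrict_mem measurableSet_Ioi).mono fun t ht ↦ ?_
  have ht' : 0 < t := ht
  have hΨ := hM t ht'
  have hB := pow_mul_exp_neg_sqrt_le_inv_one_add_sq n hc ht'
  rw [Real.norm_eq_abs, abs_mul, abs_mul, abs_mul, abs_of_pos (Real.exp_pos _),
    abs_of_pos (by norm_num : (0 : ℝ) < 4⁻¹), abs_of_pos (pow_pos ht' n)]
  have hexp : Real.exp (-(t / 2)) * Real.exp (t / 2 - c * Real.sqrt t) =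
      Real.exp (-(c * Real.sqrt t)) := by
    rw [← Real.exp_add]; congr 1; ring
  calc 4⁻¹ * Real.exp (-(t / 2)) * |zetaScrew t| * t ^ n
      ≤ 4⁻¹ * Real.exp (-(t / 2)) * (M * Real.exp (t / 2 - c * Real.sqrt t)) * t ^ n := by
        gcongr
    _ = 4⁻¹ * M * (t ^ n * Real.exp (-(c * Real.sqrt t))) := by
        rw [← hexp]; ring
    _ ≤ 4⁻¹ * M * (2 * max 1 K * (1 + t ^ 2)⁻¹) :=
        mul_le_mul_of_nonneg_left hB (by positivity)
    _ = 4⁻¹ * M * (2 * max 1 K) * (1 + t ^ 2)⁻¹ := by ring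

/-! ### E. Thm 1.8, necessity: under RH the Hankel forms are non-negative -/

/-- The Hankel quadratic form is the integral of a square against the moment weight:
`∑ᵢⱼ xᵢ μ_{i+j+s} xⱼ = ∫₀^∞ 4⁻¹e^{-t/2}Ψ(t) t^s (∑ᵢ xᵢ tⁱ)² dt` (`s = 0, 1`; the Stieltjes
moment structure behind §7.3). [cite: Suzuki2023, §7.3 (proof of Thm 1.8)] -/
theorem hankel_quadForm_eq (n s : ℕ) (x : Fin (n + 1) → ℝ) :
    ∑ i : Fin (n + 1), ∑ j : Fin (n + 1), x i * zetaScrewMoment ((i : ℕ) + (j : ℕ) + s) * x j =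
      ∫ t in Ioi (0 : ℝ), 4⁻¹ * Real.exp (-(t / 2)) * zetaScrew t * t ^ s *
        (∑ i : Fin (n + 1), x i * t ^ (i : ℕ)) ^ 2 := by
  have hint : ∀ k : ℕ, IntegrableOn (fun t : ℝ ↦ 4⁻¹ * Real.exp (-(t / 2)) * zetaScrew t * t ^ k) (Ioi 0) :=
    integrableOn_moment_integrand
  have hterm : ∀ i j : Fin (n + 1), IntegrableOn (fun t : ℝ ↦ x i * x j *
      (4⁻¹ * Real.exp (-(t / 2)) * zetaScrew t * t ^ ((i : ℕ) + (j : ℕ) + s))) (Ioi 0) :=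
    fun i j ↦ (hint _).const_mul _
  have hexpand : ∀ t : ℝ, 4⁻¹ * Real.exp (-(t / 2)) * zetaScrew t * t ^ s * (∑ i : Fin (n + 1), x i * t ^ (i : ℕ)) ^ 2 =
      ∑ i : Fin (n + 1), ∑ j : Fin (n + 1), x i * x j * (4⁻¹ * Real.exp (-(t / 2)) * zetaScrew t * t ^ ((i : ℕ) + (j : ℕ) + s)) := by
    intro t
    rw [sq, Finset.sum_mul_sum, Finset.mul_sum]
    refine Finset.sum_congr rfl fun i _ ↦ ?_
    rw [Finset.mul_sum]
    refine Finset.sum_congr rfl fun j _ ↦ ?_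
    rw [pow_add, pow_add]
    ring
  rw [setIntegral_congr_fun measurableSet_Ioi (fun t _ ↦ hexpand t),
    integral_finsetSum _ (fun i _ ↦ integrable_finsetSum _ (fun j _ ↦ hterm i j))]
  refine Finset.sum_congr rfl fun i _ ↦ ?_
  rw [integral_finsetSum _ (fun j _ ↦ hterm i j)]
  refine Finset.sum_congr rfl fun j _ ↦ ?_
  rw [integral_const_mul, zetaScrewMoment]
  ring

/-- Under RH the Hankel form with shift `s` is non-negative (`Ψ ≥ 0` by Thm 1.7, tree
`ZetaScrewThm17.zetaScrew_nonneg_of_RH`). [cite: Suzuki2023, §7.3 (proof of Thm 1.8)] -/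
theorem hankel_quadForm_nonneg_of_RH (hRH : RiemannHypothesis) (n s : ℕ) (x : Fin (n + 1) → ℝ) :
    0 ≤ ∑ i : Fin (n + 1), ∑ j : Fin (n + 1), x i * zetaScrewMoment ((i : ℕ) + (j : ℕ) + s) * x j := by
  rw [hankel_quadForm_eq]
  refine setIntegral_nonneg measurableSet_Ioi fun t ht ↦ ?_
  have ht' : 0 < t := ht
  have hΨ := ZetaScrewThm17.zetaScrew_nonneg_of_RH hRH t
  have : 0 ≤ 4⁻¹ * Real.exp (-(t / 2)) * zetaScrew t * t ^ s := by positivity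
  positivity

/-- `Δ_n` is Hermitian (real symmetric). [cite: Suzuki2023, Thm 1.8 (Hankel matrices)] -/
theorem isHermitian_zetaScrewHankel (n : ℕ) : (zetaScrewHankel n).IsHermitian := by
  refine Matrix.IsHermitian.ext fun i j ↦ ?_
  simp [zetaScrewHankel, add_comm]

/-- `Δ_n^{(1)}` is Hermitian (real symmetric). [cite: Suzuki2023, Thm 1.8 (Hankel matrices)] -/
theorem isHermitian_zetaScrewHankelShift (n : ℕ) : (zetaScrewHankelShift n).IsHermitian := by
  refine Matrix.IsHermitian.ext fun i j ↦ ?_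
  simp [zetaScrewHankelShift, add_comm]

/-- RH-CONSEQUENCE. Under RH, `Δ_n` is positive semidefinite. [cite: Suzuki2023, §7.3 (proof of Thm 1.8)] -/
theorem posSemidef_zetaScrewHankel_of_RH (hRH : RiemannHypothesis) (n : ℕ) :
    (zetaScrewHankel n).PosSemidef := by
  refine Matrix.PosSemidef.of_dotProduct_mulVec_nonneg (isHermitian_zetaScrewHankel n) fun x ↦ ?_
  have h := hankel_quadForm_nonneg_of_RH hRH n 0 x
  simp only [add_zero] at h
  have key : dotProduct (star x) ((zetaScrewHankel n).mulVec x) =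
      ∑ i : Fin (n + 1), ∑ j : Fin (n + 1), x i * zetaScrewMoment ((i : ℕ) + (j : ℕ)) * x j := by
    simp only [dotProduct, Matrix.mulVec, Pi.star_apply, star_trivial, zetaScrewHankel, Matrix.of_apply,
      Finset.mul_sum]
    refine Finset.sum_congr rfl fun i _ ↦ Finset.sum_congr rfl fun j _ ↦ ?_
    ring
  rw [key]
  exact h

/-- RH-CONSEQUENCE. Under RH, `Δ_n^{(1)}` is positive semidefinite. [cite: Suzuki2023, §7.3 (proof of Thm 1.8)] -/
theorem posSemidef_zetaScrewHankelShift_of_RH (hRH : RiemannHypothesis) (n : ℕ) :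
    (zetaScrewHankelShift n).PosSemidef := by
  refine Matrix.PosSemidef.of_dotProduct_mulVec_nonneg (isHermitian_zetaScrewHankelShift n) fun x ↦ ?_
  have h := hankel_quadForm_nonneg_of_RH hRH n 1 x
  have key : dotProduct (star x) ((zetaScrewHankelShift n).mulVec x) =
      ∑ i : Fin (n + 1), ∑ j : Fin (n + 1), x i * zetaScrewMoment ((i : ℕ) + (j : ℕ) + 1) * x j := by
    simp only [dotProduct, Matrix.mulVec, Pi.star_apply, star_trivial, zetaScrewHankelShift,
      Matrix.of_apply, Finset.mul_sum]
    refine Finset.sum_congr rfl fun i _ ↦ Finset.sum_congr rfl fun j _ ↦ ?_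
    ring
  rw [key]
  exact h

/-- RH-CONSEQUENCE (line 1). **Suzuki2023 Thm 1.8, necessity half**: under RH, `det Δ_n ≥ 0` and
`det Δ_n^{(1)} ≥ 0` for all `n` ("`{μ_n}` is a Stieltjes moment sequence for the measure
`4^{-1}e^{-t/2}Ψ(t)dt` … hence `det Δ_n ≥ 0` and `det Δ_n^{(1)} ≥ 0` [KrNu77]"; here directly:
the Hankel forms are integrals of squares, so the matrices are positive semidefinite and
`Matrix.PosSemidef.det_nonneg`). The converse half of `Suzuki2023_thm18` (determinacy of the
Stieltjes moment problem, [Lin17]) is NOT proved here. [cite: Suzuki2023, Thm 1.8 and §7.3] -/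
theorem det_zetaScrewHankel_nonneg_of_RH (hRH : RiemannHypothesis) (n : ℕ) :
    0 ≤ (zetaScrewHankel n).det ∧ 0 ≤ (zetaScrewHankelShift n).det :=
  ⟨(posSemidef_zetaScrewHankel_of_RH hRH n).det_nonneg,
    (posSemidef_zetaScrewHankelShift_of_RH hRH n).det_nonneg⟩

end ZetaScrewGrowth

/-! ### F. (11.2): the one-sided Fourier transform of the shifted screw functions `Ψ_ω` -/

namespace ZetaScrewShiftLaplace

variable {a : ℂ} {w : ℝ → ℂ}

/-! ### Laplace transforms of running integrals (Fubini on `(0,∞)²`) -/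

/-- Laplace transform of a running integral (Fubini on `(0,∞)²`): for continuous `w` with
`w(u)e^{au} ∈ L¹(0,∞)` and `Re a < 0`, `t ↦ (∫₀ᵗ w) e^{at}` is integrable on `(0,∞)` and
`∫₀^∞ (∫₀ᵗ w(u) du) e^{at} dt = -(1/a) ∫₀^∞ w(u) e^{au} du` (the "little calculation" behind
(11.2) for the term `2ω∫₀ᵗe^{-ωu}Ψ(u)du` of (11.1)). [cite: Suzuki2023, §11, (11.1)–(11.2), p. 22] -/
theorem integral_running_mul_cexp (hw : Continuous w) (ha : a.re < 0)
    (hint : IntegrableOn (fun u : ℝ ↦ w u * cexp (a * u)) (Ioi 0)) :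
    IntegrableOn (fun t : ℝ ↦ (∫ u in (0 : ℝ)..t, w u) * cexp (a * t)) (Ioi 0) ∧
      ∫ t in Ioi (0 : ℝ), (∫ u in (0 : ℝ)..t, w u) * cexp (a * t) =
        -(1 / a) * ∫ u in Ioi (0 : ℝ), w u * cexp (a * u) := by
  have ha0 : a ≠ 0 := fun h ↦ by rw [h] at ha; simp at ha
  set μ : Measure ℝ := volume.restrict (Ioi (0 : ℝ)) with hμ
  -- the two-variable integrand, `p = (t, u)`
  set G : ℝ × ℝ → ℂ := fun p ↦ if p.2 < p.1 then w p.2 * cexp (a * p.1) else 0 with hG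
  have hGmeas : Measurable G := by
    refine Measurable.ite (measurableSet_lt measurable_snd measurable_fst) ?_ measurable_const
    exact (hw.measurable.comp measurable_snd).mul
      (Complex.measurable_exp.comp (measurable_const.mul (Complex.measurable_ofReal.comp measurable_fst)))
  -- sections in `t` for fixed `u`: `𝟙_{t > u} w(u) e^{at}`
  have hsec_t : ∀ u : ℝ, (fun t : ℝ ↦ G (t, u)) = (Ioi u).indicator (fun t : ℝ ↦ w u * cexp (a * t)) := by
    intro u; funext t
    simp only [hG, Set.indicator_apply, mem_Ioi]
  -- sections in `u` for fixed `t`: `𝟙_{u < t} w(u) e^{at}`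
  have hsec_u : ∀ t : ℝ, (fun u : ℝ ↦ G (t, u)) = (Iio t).indicator (fun u : ℝ ↦ w u * cexp (a * t)) := by
    intro t; funext u
    simp only [hG, Set.indicator_apply, mem_Iio]
  -- the `t`-integral of the section at `u > 0`
  have hint_t : ∀ u : ℝ, 0 < u → ∫ t in Ioi (0 : ℝ), G (t, u) = w u * (-cexp (a * u) / a) := by
    intro u hu
    rw [show (fun t : ℝ ↦ G (t, u)) = _ from hsec_t u, setIntegral_indicator measurableSet_Ioi,
      show Ioi (0 : ℝ) ∩ Ioi u = Ioi u from by
        ext t; simp only [mem_inter_iff, mem_Ioi]; exact ⟨fun h ↦ h.2, fun h ↦ ⟨hu.trans h, h⟩⟩,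
      integral_const_mul, integral_exp_mul_complex_Ioi ha u]
  have hint_t_norm : ∀ u : ℝ, 0 < u →
      ∫ t in Ioi (0 : ℝ), ‖G (t, u)‖ = ‖w u‖ * (-Real.exp (a.re * u) / a.re) := by
    intro u hu
    have : (fun t : ℝ ↦ ‖G (t, u)‖) = (Ioi u).indicator (fun t : ℝ ↦ ‖w u‖ * Real.exp (a.re * t)) := by
      funext t
      rw [show G (t, u) = (Ioi u).indicator (fun t : ℝ ↦ w u * cexp (a * t)) t from
        congrFun (hsec_t u) t]
      by_cases h : t ∈ Ioi u
      · simp only [Set.indicator_of_mem h, norm_mul, ZetaScrewLaplace.norm_cexp_mul_ofReal]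
      · simp only [Set.indicator_of_notMem h, norm_zero]
    rw [this, setIntegral_indicator measurableSet_Ioi,
      show Ioi (0 : ℝ) ∩ Ioi u = Ioi u from by
        ext t; simp only [mem_inter_iff, mem_Ioi]; exact ⟨fun h ↦ h.2, fun h ↦ ⟨hu.trans h, h⟩⟩,
      integral_const_mul, integral_exp_mul_Ioi ha u]
  -- integrability on the product
  have hGint : Integrable G (μ.prod μ) := by
    rw [integrable_prod_iff' hGmeas.aestronglyMeasurable]
    refine ⟨?_, ?_⟩
    · refine (ae_restrict_mem measurableSet_Ioi).mono fun u hu ↦ ?_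
      rw [hsec_t u]
      have hf : IntegrableOn (fun t : ℝ ↦ w u * cexp (a * t)) (Ioi u) :=
        (integrableOn_exp_mul_complex_Ioi ha u).const_mul (w u)
      exact (hf.integrable_indicator measurableSet_Ioi).mono_measure Measure.restrict_le_self
    · have h2 : IntegrableOn (fun u : ℝ ↦ ‖w u‖ * (-Real.exp (a.re * u) / a.re)) (Ioi 0) := by
        have h3 : IntegrableOn (fun u : ℝ ↦ ‖w u * cexp (a * u)‖ * (-1 / a.re)) (Ioi 0) :=
          hint.norm.mul_const _
        refine h3.congr_fun (fun u _ ↦ ?_) measurableSet_Ioi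
        dsimp only
        rw [norm_mul, ZetaScrewLaplace.norm_cexp_mul_ofReal]
        field_simp
      exact h2.congr_fun (fun u hu ↦ (hint_t_norm u hu).symm) measurableSet_Ioi
  refine ⟨?_, ?_⟩
  · -- integrability of `t ↦ ∫_u G(t,u)` and identification
    have h1 : Integrable (fun t : ℝ ↦ ∫ u, G (t, u) ∂μ) μ := hGint.integral_prod_left
    refine h1.congr ?_
    refine (ae_restrict_mem measurableSet_Ioi).mono fun t ht ↦ ?_
    have ht' : (0 : ℝ) ≤ t := le_of_lt ht
    show ∫ u in Ioi (0 : ℝ), G (t, u) = (∫ u in (0 : ℝ)..t, w u) * cexp (a * t)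
    rw [show (fun u : ℝ ↦ G (t, u)) = _ from hsec_u t, setIntegral_indicator measurableSet_Iio,
      show Ioi (0 : ℝ) ∩ Iio t = Ioo 0 t from rfl, integral_mul_const,
      intervalIntegral.integral_of_le ht', integral_Ioc_eq_integral_Ioo]
  · -- Fubini
    have hswap := integral_integral_swap (f := fun t u ↦ G (t, u)) (μ := μ) (ν := μ) hGint
    have hL : ∫ t in Ioi (0 : ℝ), (∫ u in (0 : ℝ)..t, w u) * cexp (a * t) = ∫ t, ∫ u, G (t, u) ∂μ ∂μ := by
      refine setIntegral_congr_fun measurableSet_Ioi fun t ht ↦ ?_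
      have ht' : (0 : ℝ) ≤ t := le_of_lt ht
      show (∫ u in (0 : ℝ)..t, w u) * cexp (a * t) = ∫ u in Ioi (0 : ℝ), G (t, u)
      rw [show (fun u : ℝ ↦ G (t, u)) = _ from hsec_u t, setIntegral_indicator measurableSet_Iio,
        show Ioi (0 : ℝ) ∩ Iio t = Ioo 0 t from rfl, integral_mul_const,
        intervalIntegral.integral_of_le ht', integral_Ioc_eq_integral_Ioo]
    rw [hL, hswap]
    have hR : ∫ u, ∫ t, G (t, u) ∂μ ∂μ = ∫ u in Ioi (0 : ℝ), w u * (-cexp (a * u) / a) :=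
      setIntegral_congr_fun measurableSet_Ioi fun u hu ↦ hint_t u hu
    rw [hR, ← integral_const_mul]
    refine setIntegral_congr_fun measurableSet_Ioi fun u _ ↦ ?_
    field_simp

/-- Laplace transform of the second running integral (Fubini on `(0,∞)²`, inner integral
`∫_u^∞ (t-u)e^{at}dt = e^{au}/a²` = `ZetaScrewLaplace.integral_max_sub_mul_cexp`): for continuous
`w` with `w(u)e^{au} ∈ L¹(0,∞)` and `Re a < 0`, `t ↦ (∫₀ᵗ (t-u) w(u) du) e^{at}` is integrable on
`(0,∞)` and `∫₀^∞ (∫₀ᵗ (t-u) w(u) du) e^{at} dt = (1/a²) ∫₀^∞ w(u) e^{au} du` (the term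
`ω²∫₀ᵗ(t-u)e^{-ωu}Ψ(u)du` of (11.1)). [cite: Suzuki2023, §11, (11.1)–(11.2), p. 22] -/
theorem integral_ramp_mul_cexp (hw : Continuous w) (ha : a.re < 0)
    (hint : IntegrableOn (fun u : ℝ ↦ w u * cexp (a * u)) (Ioi 0)) :
    IntegrableOn (fun t : ℝ ↦ (∫ u in (0 : ℝ)..t, ((t - u : ℝ) : ℂ) * w u) * cexp (a * t)) (Ioi 0) ∧
      ∫ t in Ioi (0 : ℝ), (∫ u in (0 : ℝ)..t, ((t - u : ℝ) : ℂ) * w u) * cexp (a * t) =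
        (1 / a ^ 2) * ∫ u in Ioi (0 : ℝ), w u * cexp (a * u) := by
  have ha0 : a ≠ 0 := fun h ↦ by rw [h] at ha; simp at ha
  have hare0 : a.re ≠ 0 := ha.ne
  set μ : Measure ℝ := volume.restrict (Ioi (0 : ℝ)) with hμ
  set G : ℝ × ℝ → ℂ := fun p ↦ if p.2 < p.1 then ((p.1 - p.2 : ℝ) : ℂ) * w p.2 * cexp (a * p.1) else 0
    with hG
  have hGmeas : Measurable G := by
    refine Measurable.ite (measurableSet_lt measurable_snd measurable_fst) ?_ measurable_const
    exact ((Complex.measurable_ofReal.comp (measurable_fst.sub measurable_snd)).mul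
      (hw.measurable.comp measurable_snd)).mul
      (Complex.measurable_exp.comp (measurable_const.mul (Complex.measurable_ofReal.comp measurable_fst)))
  -- `t`-sections via the ramp `(t - u)₊`
  have hsec_t : ∀ u : ℝ, (fun t : ℝ ↦ G (t, u)) =
      fun t : ℝ ↦ w u * (((max (t - u) 0 : ℝ) : ℂ) * cexp (a * t)) := by
    intro u; funext t
    simp only [hG]
    split_ifs with h
    · rw [max_eq_left (by linarith)]; ring
    · rw [max_eq_right (by linarith)]; simp
  -- `u`-sections
  have hsec_u : ∀ t : ℝ, (fun u : ℝ ↦ G (t, u)) =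
      (Iio t).indicator (fun u : ℝ ↦ ((t - u : ℝ) : ℂ) * w u * cexp (a * t)) := by
    intro t; funext u
    simp only [hG, Set.indicator_apply, mem_Iio]
  have hint_t : ∀ u : ℝ, 0 < u → ∫ t in Ioi (0 : ℝ), G (t, u) = w u * (cexp (a * u) / a ^ 2) := by
    intro u hu
    rw [show (fun t : ℝ ↦ G (t, u)) = _ from hsec_t u, integral_const_mul,
      ZetaScrewLaplace.integral_max_sub_mul_cexp hu.le ha]
  have hint_t_norm : ∀ u : ℝ, 0 < u →
      ∫ t in Ioi (0 : ℝ), ‖G (t, u)‖ = ‖w u‖ * (Real.exp (a.re * u) / a.re ^ 2) := by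
    intro u hu
    have : (fun t : ℝ ↦ ‖G (t, u)‖) = fun t : ℝ ↦ ‖w u‖ * (max (t - u) 0 * Real.exp (a.re * t)) := by
      funext t
      rw [show G (t, u) = w u * (((max (t - u) 0 : ℝ) : ℂ) * cexp (a * t)) from congrFun (hsec_t u) t,
        norm_mul, norm_mul, Complex.norm_real, Real.norm_eq_abs, abs_of_nonneg (le_max_right _ _),
        ZetaScrewLaplace.norm_cexp_mul_ofReal]
    rw [this, integral_const_mul, ZetaScrewLaplace.integral_max_sub_mul_exp hu.le ha]
  have hGint : Integrable G (μ.prod μ) := by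
    rw [integrable_prod_iff' hGmeas.aestronglyMeasurable]
    refine ⟨?_, ?_⟩
    · refine (ae_restrict_mem measurableSet_Ioi).mono fun u hu ↦ ?_
      rw [hsec_t u]
      have hf : IntegrableOn (fun t : ℝ ↦ ((max (t - u) 0 : ℝ) : ℂ) * cexp (a * t)) (Ioi 0) :=
        ZetaScrewLaplace.integrableOn_max_sub_mul_cexp (le_of_lt hu) ha
      exact hf.const_mul (w u)
    · have h2 : IntegrableOn (fun u : ℝ ↦ ‖w u‖ * (Real.exp (a.re * u) / a.re ^ 2)) (Ioi 0) := by
        have h3 : IntegrableOn (fun u : ℝ ↦ ‖w u * cexp (a * u)‖ * (1 / a.re ^ 2)) (Ioi 0) :=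
          hint.norm.mul_const _
        refine h3.congr_fun (fun u _ ↦ ?_) measurableSet_Ioi
        dsimp only
        rw [norm_mul, ZetaScrewLaplace.norm_cexp_mul_ofReal]
        field_simp
      exact h2.congr_fun (fun u hu ↦ (hint_t_norm u hu).symm) measurableSet_Ioi
  have hinner : ∀ t : ℝ, 0 < t →
      ∫ u in Ioi (0 : ℝ), G (t, u) = (∫ u in (0 : ℝ)..t, ((t - u : ℝ) : ℂ) * w u) * cexp (a * t) := by
    intro t ht
    rw [show (fun u : ℝ ↦ G (t, u)) = _ from hsec_u t, setIntegral_indicator measurableSet_Iio,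
      show Ioi (0 : ℝ) ∩ Iio t = Ioo 0 t from rfl, integral_mul_const,
      intervalIntegral.integral_of_le ht.le, integral_Ioc_eq_integral_Ioo]
  refine ⟨?_, ?_⟩
  · have h1 : Integrable (fun t : ℝ ↦ ∫ u, G (t, u) ∂μ) μ := hGint.integral_prod_left
    refine h1.congr ?_
    exact (ae_restrict_mem measurableSet_Ioi).mono fun t ht ↦ hinner t ht
  · have hswap := integral_integral_swap (f := fun t u ↦ G (t, u)) (μ := μ) (ν := μ) hGint
    have hL : ∫ t in Ioi (0 : ℝ), (∫ u in (0 : ℝ)..t, ((t - u : ℝ) : ℂ) * w u) * cexp (a * t) =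
        ∫ t, ∫ u, G (t, u) ∂μ ∂μ :=
      setIntegral_congr_fun measurableSet_Ioi fun t ht ↦ (hinner t ht).symm
    rw [hL, hswap]
    have hR : ∫ u, ∫ t, G (t, u) ∂μ ∂μ = ∫ u in Ioi (0 : ℝ), w u * (cexp (a * u) / a ^ 2) :=
      setIntegral_congr_fun measurableSet_Ioi fun u hu ↦ hint_t u hu
    rw [hR, ← integral_const_mul]
    refine setIntegral_congr_fun measurableSet_Ioi fun u _ ↦ ?_
    field_simp

/-! ### (11.2): the one-sided Fourier transform of `Ψ_ω` -/

/-- `Ψ_ω(t)` for `t > 0`, cast to `ℂ`, in terms of `W(u) = e^{-ωu}Ψ(u)` ((11.1) with `|t| = t`).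
[cite: Suzuki2023, (11.1), p. 22] -/
theorem zetaScrewShift_ofReal_of_pos (ω : ℝ) {t : ℝ} (ht : 0 < t) :
    (zetaScrewShift ω t : ℂ) =
      ((Real.exp (-(ω * t)) * zetaScrew t : ℝ) : ℂ) +
        2 * (ω : ℂ) * (∫ u in (0 : ℝ)..t, ((Real.exp (-(ω * u)) * zetaScrew u : ℝ) : ℂ)) +
          (ω : ℂ) ^ 2 * (∫ u in (0 : ℝ)..t,
            ((t - u : ℝ) : ℂ) * ((Real.exp (-(ω * u)) * zetaScrew u : ℝ) : ℂ)) := by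
  rw [zetaScrewShift, abs_of_pos ht]
  have h1 : ((∫ u in (0 : ℝ)..t, Real.exp (-(ω * u)) * zetaScrew u : ℝ) : ℂ) =
      ∫ u in (0 : ℝ)..t, ((Real.exp (-(ω * u)) * zetaScrew u : ℝ) : ℂ) :=
    intervalIntegral.integral_ofReal.symm
  have h2 : ((∫ u in (0 : ℝ)..t, (t - u) * Real.exp (-(ω * u)) * zetaScrew u : ℝ) : ℂ) =
      ∫ u in (0 : ℝ)..t, ((t - u : ℝ) : ℂ) * ((Real.exp (-(ω * u)) * zetaScrew u : ℝ) : ℂ) := by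
    rw [← intervalIntegral.integral_ofReal]
    refine intervalIntegral.integral_congr fun u _ ↦ ?_
    push_cast
    ring
  rw [Complex.ofReal_add, Complex.ofReal_add,
    show ((2 * ω * ∫ u in (0 : ℝ)..t, Real.exp (-(ω * u)) * zetaScrew u : ℝ) : ℂ) =
      2 * (ω : ℂ) * ((∫ u in (0 : ℝ)..t, Real.exp (-(ω * u)) * zetaScrew u : ℝ) : ℂ) by push_cast; ring,
    show ((ω ^ 2 * ∫ u in (0 : ℝ)..t, (t - u) * Real.exp (-(ω * u)) * zetaScrew u : ℝ) : ℂ) =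
      (ω : ℂ) ^ 2 * ((∫ u in (0 : ℝ)..t, (t - u) * Real.exp (-(ω * u)) * zetaScrew u : ℝ) : ℂ) by
      push_cast; ring,
    h1, h2]

/-- **(11.2) as a theorem**: for real `ω` and `Im z > max(1/2 - ω, 0)`, `Ψ_ω(t)e^{izt} ∈ L¹(0,∞)` and
`∫₀^∞ Ψ_ω(t)e^{izt}dt = -z^{-2}(ξ'/ξ)(1/2 + ω - iz)` (the three terms of (11.1) transform to
`V`, `2ω·(i/z)V`, `-ω²z^{-2}V` with `V = ∫₀^∞Ψ(u)e^{(iz-ω)u}du = -(z+iω)^{-2}(ξ'/ξ)(1/2+ω-iz)` by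
Thm 1.1 (1) = `ZetaScrewLaplace.integral_zetaScrew_mul_cexp`, and `(1 + iω/z)² = (z+iω)²/z²`).
[cite: Suzuki2023, (11.2), p. 22] -/
theorem laplace_zetaScrewShift : Suzuki2023_eq112 := by
  intro ω z hz
  have hz0 : 0 < z.im := lt_of_le_of_lt (le_max_right _ _) hz
  have hzω : 1 / 2 - ω < z.im := lt_of_le_of_lt (le_max_left _ _) hz
  have hzne : z ≠ 0 := fun h ↦ by rw [h] at hz0; simp at hz0
  set a : ℂ := I * z with ha_def
  have hare : a.re = -z.im := by simp [ha_def]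
  have ha : a.re < 0 := by rw [hare]; linarith
  have haω : (a - ω).re < -1 / 2 := by
    simp only [sub_re, ofReal_re, hare]; linarith
  have ha0 : a ≠ 0 := fun h ↦ by rw [h] at ha; simp at ha
  have haω0 : a - ω ≠ 0 := fun h ↦ by rw [h] at haω; simp at haω; linarith
  set W : ℝ → ℂ := fun u ↦ ((Real.exp (-(ω * u)) * zetaScrew u : ℝ) : ℂ) with hW
  have hWc : Continuous W :=
    Complex.continuous_ofReal.comp
      ((Real.continuous_exp.comp (continuous_const.mul continuous_id).neg).mul continuous_zetaScrew)
  have hWexp : ∀ u : ℝ, W u * cexp (a * u) = (zetaScrew u : ℂ) * cexp ((a - ω) * u) := by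
    intro u
    simp only [hW]
    push_cast
    rw [mul_comm (cexp _) (zetaScrew u : ℂ), mul_assoc, ← Complex.exp_add]
    congr 2
    ring
  obtain ⟨hVint, hVeq⟩ := ZetaScrewLaplace.integral_zetaScrew_mul_cexp haω
  have hint : IntegrableOn (fun u : ℝ ↦ W u * cexp (a * u)) (Ioi 0) :=
    hVint.congr_fun (fun u _ ↦ (hWexp u).symm) measurableSet_Ioi
  have hV : ∫ u in Ioi (0 : ℝ), W u * cexp (a * u) =
      1 / (a - ω) ^ 2 * logDeriv riemannXi (1 / 2 - (a - ω)) := by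
    rw [setIntegral_congr_fun measurableSet_Ioi (fun u _ ↦ hWexp u), hVeq]
  obtain ⟨h2int, h2eq⟩ := integral_running_mul_cexp hWc ha hint
  obtain ⟨h3int, h3eq⟩ := integral_ramp_mul_cexp hWc ha hint
  have hpt : ∀ t : ℝ, t ∈ Ioi (0 : ℝ) → (zetaScrewShift ω t : ℂ) * cexp (I * z * t) =
      W t * cexp (a * t) + 2 * (ω : ℂ) * ((∫ u in (0 : ℝ)..t, W u) * cexp (a * t)) +
        (ω : ℂ) ^ 2 * ((∫ u in (0 : ℝ)..t, ((t - u : ℝ) : ℂ) * W u) * cexp (a * t)) := by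
    intro t ht
    rw [zetaScrewShift_ofReal_of_pos ω (mem_Ioi.1 ht), ← ha_def]
    simp only [hW]
    ring
  have hsum : IntegrableOn (fun t : ℝ ↦ W t * cexp (a * t) +
      2 * (ω : ℂ) * ((∫ u in (0 : ℝ)..t, W u) * cexp (a * t)) +
        (ω : ℂ) ^ 2 * ((∫ u in (0 : ℝ)..t, ((t - u : ℝ) : ℂ) * W u) * cexp (a * t))) (Ioi 0) :=
    (hint.add (h2int.const_mul _)).add (h3int.const_mul _)
  refine ⟨hsum.congr_fun (fun t ht ↦ (hpt t ht).symm) measurableSet_Ioi, ?_⟩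
  have hI2 : IntegrableOn (fun t : ℝ ↦ 2 * (ω : ℂ) * ((∫ u in (0 : ℝ)..t, W u) * cexp (a * t))) (Ioi 0) :=
    h2int.const_mul _
  have hI3 : IntegrableOn (fun t : ℝ ↦
      (ω : ℂ) ^ 2 * ((∫ u in (0 : ℝ)..t, ((t - u : ℝ) : ℂ) * W u) * cexp (a * t))) (Ioi 0) :=
    h3int.const_mul _
  have hI1 : IntegrableOn (fun t : ℝ ↦ W t * cexp (a * t) +
      2 * (ω : ℂ) * ((∫ u in (0 : ℝ)..t, W u) * cexp (a * t))) (Ioi 0) := hint.add hI2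
  rw [setIntegral_congr_fun measurableSet_Ioi hpt, integral_add hI1 hI3, integral_add hint hI2,
    integral_const_mul, integral_const_mul, h2eq, h3eq, hV, logDeriv_apply]
  have hs : (1 : ℂ) / 2 - (a - ω) = 1 / 2 + ω - I * z := by rw [ha_def]; ring
  rw [hs]
  set L : ℂ := deriv riemannXi (1 / 2 + ω - I * z) / riemannXi (1 / 2 + ω - I * z)
  have ha2 : a ^ 2 = -z ^ 2 := by rw [ha_def, mul_pow, I_sq]; ring
  field_simp
  rw [ha2]
  ring

end ZetaScrewShiftLaplace


/-! ### H. (1.15): the moments as Taylor coefficients of `(1-2X)^{-2}(ξ'/ξ)(1-X)` -/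

namespace ZetaScrewMomentDeriv

/-- `∫_1^∞ Ψ(log x)(-log x)ⁿ x^{-(s+1)} dx = ∫_0^∞ Ψ(t)(-t)ⁿ e^{-st} dt` (the substitution `x = e^t` in
the tree's `Landau.mellinIoiLog`). [cite: Suzuki2023, (1.2) and (1.15)] -/
theorem mellinIoiLog_zetaScrew_log (n : ℕ) (s : ℂ) :
    Landau.mellinIoiLog (fun x ↦ zetaScrew (Real.log x)) n s =
      ∫ t in Ioi (0 : ℝ), (zetaScrew t : ℂ) * ((-(t : ℂ)) ^ n * cexp (-s * t)) := by
  unfold Landau.mellinIoiLog Landau.mellinIntegrand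
  rw [ZetaScrewLandau.integral_Ioi_one_eq_integral_Ioi_zero]
  refine setIntegral_congr_fun measurableSet_Ioi fun t _ ↦ ?_
  dsimp only
  rw [Real.log_exp, ZetaScrewLandau.ofReal_exp_cpow, Complex.real_smul, Complex.ofReal_exp]
  have : cexp (t : ℂ) * cexp ((t : ℂ) * -(s + 1)) = cexp (-s * t) := by
    rw [← Complex.exp_add]
    congr 1
    ring
  rw [← this]
  ring

/-- The function `R(X) = (1-2X)^{-2}(ξ'/ξ)(1-X)` of (1.15) is `4^{-1}∫₀^∞Ψ(t)e^{-(1/2-X)t}dt` for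
`Re X < 0` ("changing of variables as `z = (i/2)(1-2X)` in (1.2)"). [cite: Suzuki2023, (1.15), p. 4] -/
theorem R_eq_of_re_neg {X : ℂ} (hX : X.re < 0) :
    1 / (1 - 2 * X) ^ 2 * (deriv riemannXi (1 - X) / riemannXi (1 - X)) =
      4⁻¹ * Landau.mellinIoi (fun x ↦ zetaScrew (Real.log x)) (1 / 2 - X) := by
  have hs : 1 / 2 < ((1 : ℂ) / 2 - X).re := by simp; linarith
  rw [ZetaScrewLandau.mellinIoi_eq_of_re_gt hs, logDeriv_apply,
    show (1 : ℂ) / 2 + (1 / 2 - X) = 1 - X by ring]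
  have h2 : (1 : ℂ) - 2 * X = 2 * (1 / 2 - X) := by ring
  rw [h2, mul_pow]
  have hne : ((1 : ℂ) / 2 - X) ≠ 0 := by
    intro h; have := congrArg Complex.re h; simp at this; linarith
  field_simp
  ring

/-- The iterated derivatives of `R` on the left half-plane (differentiation under the integral
sign, tree `Landau.iteratedDeriv_mellinIoi`): `R^{(n)}(X) = 4^{-1}∫₀^∞ Ψ(t) tⁿ e^{-(1/2 - X)t} dt` for
`Re X < 0`. [cite: Suzuki2023, (1.15), p. 4] -/
theorem iteratedDeriv_R_eq {X : ℂ} (hX : X.re < 0) (n : ℕ) :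
    iteratedDeriv n (fun X : ℂ ↦ 1 / (1 - 2 * X) ^ 2 * (deriv riemannXi (1 - X) / riemannXi (1 - X))) X =
      4⁻¹ * ∫ t in Ioi (0 : ℝ), (zetaScrew t : ℂ) * ((t : ℂ) ^ n * cexp (-(1 / 2 - X) * t)) := by
  -- `R` agrees near `X` with `4⁻¹ Φ(1/2 - ·)`
  have hopen : IsOpen {X : ℂ | X.re < 0} := isOpen_lt Complex.continuous_re continuous_const
  have hev : (fun X : ℂ ↦ 1 / (1 - 2 * X) ^ 2 * (deriv riemannXi (1 - X) / riemannXi (1 - X))) =ᶠ[𝓝 X]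
      (fun X : ℂ ↦ 4⁻¹ * Landau.mellinIoi (fun x ↦ zetaScrew (Real.log x)) (1 / 2 - X)) := by
    filter_upwards [hopen.mem_nhds hX] with Y hY
    exact R_eq_of_re_neg hY
  rw [hev.iteratedDeriv_eq n, iteratedDeriv_const_mul_field,
    show (fun X : ℂ ↦ Landau.mellinIoi (fun x ↦ zetaScrew (Real.log x)) (1 / 2 - X)) =
      fun X : ℂ ↦ (fun s ↦ Landau.mellinIoi (fun x ↦ zetaScrew (Real.log x)) s) (1 / 2 - X) from rfl,
    iteratedDeriv_comp_const_sub]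
  dsimp only
  -- the tree's derivative formula on `Re s > 1/2`
  have hg : Measurable (fun x ↦ zetaScrew (Real.log x)) :=
    continuous_zetaScrew.measurable.comp Real.measurable_log
  set σ₁ : ℝ := (1 / 2 + (1 / 2 - X).re) / 2 with hσ₁
  have hσ₁' : 1 / 2 < σ₁ := by rw [hσ₁]; simp; linarith
  have hσ₁s : σ₁ < ((1 : ℂ) / 2 - X).re := by rw [hσ₁]; simp; linarith
  have hint := ZetaScrewLandau.integrableOn_zetaScrew_log_rpow hσ₁'
  rw [Landau.iteratedDeriv_mellinIoi hg hint n hσ₁s, mellinIoiLog_zetaScrew_log, smul_eq_mul,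
    ← integral_const_mul, ← integral_const_mul, ← integral_const_mul]
  refine setIntegral_congr_fun measurableSet_Ioi fun t _ ↦ ?_
  rw [neg_pow]
  have h1 : ((-1 : ℂ) ^ n) * (-1) ^ n = 1 := by
    rw [← mul_pow]; norm_num
  linear_combination (4⁻¹ * (zetaScrew t : ℂ) * (t : ℂ) ^ n * cexp (-(1 / 2 - X) * t)) * h1

/-- `R` is analytic on the open set `{X | ξ(1 - X) ≠ 0, 1 - 2X ≠ 0}`, which contains `0`
(`ξ(1) = 1/2 ≠ 0`). [cite: Suzuki2023, (1.15), p. 4] -/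
theorem analyticOnNhd_R :
    AnalyticOnNhd ℂ (fun X : ℂ ↦ 1 / (1 - 2 * X) ^ 2 * (deriv riemannXi (1 - X) / riemannXi (1 - X)))
      {X : ℂ | riemannXi (1 - X) ≠ 0 ∧ 1 - 2 * X ≠ 0} := by
  intro X hX
  have h1 : AnalyticAt ℂ (fun X : ℂ ↦ 1 / (1 - 2 * X) ^ 2) X :=
    analyticAt_const.div ((analyticAt_const.sub (analyticAt_const.mul analyticAt_id)).pow 2)
      (pow_ne_zero 2 hX.2)
  have hsub : AnalyticAt ℂ (fun X : ℂ ↦ (1 : ℂ) - X) X := analyticAt_const.sub analyticAt_id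
  have h2 : AnalyticAt ℂ (fun X : ℂ ↦ deriv riemannXi (1 - X)) X :=
    ((differentiable_riemannXi.analyticAt _).deriv).comp hsub
  have h3 : AnalyticAt ℂ (fun X : ℂ ↦ riemannXi (1 - X)) X :=
    (differentiable_riemannXi.analyticAt _).comp hsub
  exact h1.mul (h2.div h3 hX.1)

/-- **Suzuki2023 (1.15) as a theorem**: `μ_n = dⁿ/dXⁿ[(1-2X)^{-2}(ξ'/ξ)(1-X)]_{X=0}` for every `n`
("Changing of variables as `z = (i/2)(1-2X)` in (1.2) and then expanding `exp(izt)` to the power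
series of `X`"). Unconditionally the Laplace integral of `4^{-1}e^{-t/2}Ψ(t)e^{Xt}` converges only
for `Re X ≤ 0`, so the printed termwise expansion is replaced by: `R^{(n)}(X) = 4^{-1}∫Ψtⁿe^{-(1/2-X)t}`
for `X < 0` (previous lemma), `R^{(n)}` is continuous at `0` (analyticity), and the integrals tend to
`μ_n` as `X → 0⁻` by dominated convergence (dominant `4^{-1}e^{-t/2}|Ψ(t)|tⁿ ∈ L¹`,
`ZetaScrewGrowth.integrableOn_moment_integrand`). This is the analytic input of Thm 8.1 / (8.6).
[cite: Suzuki2023, (1.15), p. 4 (arXiv p0004:L40–47)] -/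
theorem zetaScrewMoment_eq_iteratedDeriv (n : ℕ) :
    (zetaScrewMoment n : ℂ) =
      iteratedDeriv n (fun X : ℂ ↦ 1 / (1 - 2 * X) ^ 2 * (deriv riemannXi (1 - X) / riemannXi (1 - X))) 0 := by
  set R : ℂ → ℂ := fun X : ℂ ↦ 1 / (1 - 2 * X) ^ 2 * (deriv riemannXi (1 - X) / riemannXi (1 - X))
    with hR
  -- (1) continuity of `R^{(n)}` at `0`: `R^{(n)}(X) → R^{(n)}(0)` as `X → 0⁻` along the reals
  set U : Set ℂ := {X : ℂ | riemannXi (1 - X) ≠ 0 ∧ 1 - 2 * X ≠ 0} with hU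
  have hUo : IsOpen U := by
    have h1 : IsOpen {X : ℂ | riemannXi (1 - X) ≠ 0} :=
      isOpen_compl_singleton.preimage (differentiable_riemannXi.continuous.comp (by fun_prop))
    have h2 : IsOpen {X : ℂ | (1 : ℂ) - 2 * X ≠ 0} := isOpen_compl_singleton.preimage (by fun_prop)
    exact h1.inter h2
  have h0U : (0 : ℂ) ∈ U := by
    refine ⟨?_, by norm_num⟩
    simpa using riemannXi_ne_zero_of_one_le_re (s := 1) (by simp)
  have hRan : AnalyticOnNhd ℂ (iteratedDeriv n R) U := by
    rw [iteratedDeriv_eq_iterate]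
    exact analyticOnNhd_R.iterated_deriv n
  have hcont : ContinuousAt (iteratedDeriv n R) 0 := (hRan 0 h0U).continuousAt
  have hlim1 : Tendsto (fun X : ℝ ↦ iteratedDeriv n R (X : ℂ)) (𝓝[<] 0) (𝓝 (iteratedDeriv n R 0)) := by
    have h : Tendsto (fun X : ℝ ↦ (X : ℂ)) (𝓝[<] 0) (𝓝 (0 : ℂ)) := by
      have := (Complex.continuous_ofReal.tendsto 0)
      rw [Complex.ofReal_zero] at this
      exact this.mono_left nhdsWithin_le_nhds
    exact hcont.tendsto.comp h
  -- (2) for `X < 0` real, `R^{(n)}(X) = 4⁻¹ ∫ Ψ tⁿ e^{-(1/2-X)t}`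
  have heq : ∀ X : ℝ, X < 0 → iteratedDeriv n R (X : ℂ) =
      4⁻¹ * ∫ t in Ioi (0 : ℝ), (zetaScrew t : ℂ) * ((t : ℂ) ^ n * cexp (-(1 / 2 - (X : ℂ)) * t)) :=
    fun X hX ↦ iteratedDeriv_R_eq (by simpa using hX) n
  -- (3) dominated convergence: the integrals tend to `∫ Ψ tⁿ e^{-t/2}` as `X → 0⁻`
  have hbound_int : IntegrableOn (fun t : ℝ ↦ 4⁻¹ * Real.exp (-(t / 2)) * zetaScrew t * t ^ n) (Ioi 0) :=
    ZetaScrewGrowth.integrableOn_moment_integrand n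
  have hlim2 : Tendsto (fun X : ℝ ↦ ∫ t in Ioi (0 : ℝ), (zetaScrew t : ℂ) * ((t : ℂ) ^ n * cexp (-(1 / 2 - (X : ℂ)) * t)))
      (𝓝[<] 0) (𝓝 (∫ t in Ioi (0 : ℝ), (zetaScrew t : ℂ) * ((t : ℂ) ^ n * cexp (-(1 / 2) * t)))) := by
    refine tendsto_integral_filter_of_dominated_convergence
      (fun t : ℝ ↦ |zetaScrew t| * t ^ n * Real.exp (-(t / 2))) ?_ ?_ ?_ ?_
    · refine Eventually.of_forall fun X ↦ ?_
      exact (Continuous.aestronglyMeasurable (by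
        exact (Complex.continuous_ofReal.comp continuous_zetaScrew).mul
          (((Complex.continuous_ofReal).pow n).mul (Complex.continuous_exp.comp
            (continuous_const.mul Complex.continuous_ofReal)))))
    · refine (eventually_nhdsWithin_of_forall fun X (hX : X < 0) ↦ ?_)
      refine (ae_restrict_mem measurableSet_Ioi).mono fun t (ht : 0 < t) ↦ ?_
      rw [norm_mul, norm_mul, Complex.norm_real, norm_pow, Complex.norm_real, Real.norm_eq_abs,
        Real.norm_eq_abs, abs_of_pos ht,
        show -(1 / 2 - (X : ℂ)) * (t : ℂ) = (((-(1 / 2 - X)) : ℝ) : ℂ) * (t : ℂ) by push_cast; ring,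
        ZetaScrewLaplace.norm_cexp_mul_ofReal, Complex.ofReal_re]
      have hexp : Real.exp (-(1 / 2 - X) * t) ≤ Real.exp (-(t / 2)) :=
        Real.exp_le_exp.2 (by nlinarith)
      have h0 : 0 ≤ |zetaScrew t| * t ^ n := by positivity
      calc |zetaScrew t| * (t ^ n * Real.exp (-(1 / 2 - X) * t))
          = |zetaScrew t| * t ^ n * Real.exp (-(1 / 2 - X) * t) := by ring
        _ ≤ |zetaScrew t| * t ^ n * Real.exp (-(t / 2)) := mul_le_mul_of_nonneg_left hexp h0
    · have h4 : IntegrableOn (fun t : ℝ ↦ ‖4⁻¹ * Real.exp (-(t / 2)) * zetaScrew t * t ^ n‖ * 4) (Ioi 0) :=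
        hbound_int.norm.mul_const 4
      refine h4.congr_fun (fun t ht ↦ ?_) measurableSet_Ioi
      have ht' : 0 < t := ht
      dsimp only
      rw [Real.norm_eq_abs, abs_mul, abs_mul, abs_mul, abs_of_pos (Real.exp_pos _),
        abs_of_pos (by norm_num : (0:ℝ) < 4⁻¹), abs_of_pos (pow_pos ht' n)]
      ring
    · refine (ae_restrict_mem measurableSet_Ioi).mono fun t _ ↦ ?_
      have hc : Continuous (fun X : ℝ ↦ (zetaScrew t : ℂ) * ((t : ℂ) ^ n * cexp (-(1 / 2 - (X : ℂ)) * t))) := by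
        fun_prop
      have := hc.tendsto 0
      simp only [Complex.ofReal_zero, sub_zero] at this
      exact this.mono_left nhdsWithin_le_nhds
  -- (4) the limit integral is `4 μ_n`
  have hval : ∫ t in Ioi (0 : ℝ), (zetaScrew t : ℂ) * ((t : ℂ) ^ n * cexp (-(1 / 2) * t)) =
      4 * (zetaScrewMoment n : ℂ) := by
    rw [zetaScrewMoment, ← integral_complex_ofReal, ← integral_const_mul]
    refine setIntegral_congr_fun measurableSet_Ioi fun t _ ↦ ?_
    push_cast
    have : cexp (-((t : ℂ) / 2)) = cexp (-(1 / 2) * t) := by congr 1; ring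
    rw [this]
    ring
  -- (5) conclude by uniqueness of limits
  have hlim2' : Tendsto (fun X : ℝ ↦ iteratedDeriv n R (X : ℂ)) (𝓝[<] 0) (𝓝 (4⁻¹ * (4 * (zetaScrewMoment n : ℂ)))) := by
    rw [← hval]
    refine ((hlim2.const_mul (4⁻¹ : ℂ))).congr' ?_
    filter_upwards [self_mem_nhdsWithin] with X hX
    exact (heq X hX).symm
  have := tendsto_nhds_unique hlim1 hlim2'
  rw [this]
  ring

end ZetaScrewMomentDeriv

/-- **Discharge of `Suzuki2023_thm16`** (Suzuki2023 Thm 1.6: RH iff `Ψ = O(1)` on `[0,∞)`), both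
directions proved (`ZetaScrewGrowth.riemannHypothesis_iff_zetaScrew_bounded`). [cite: Suzuki2023, Thm 1.6 and §7.1] -/
theorem Suzuki2023_thm16_holds : Suzuki2023_thm16 :=
  ZetaScrewGrowth.riemannHypothesis_iff_zetaScrew_bounded

/-- **Discharge of `Suzuki2023_zetaScrew_notMemLp`** (Suzuki2023, remark after Thm 1.6: `Ψ`
belongs to neither `L¹(0,∞)` nor `L²(0,∞)`, unconditionally). [cite: Suzuki2023, p. 3, remark after Thm 1.6] -/
theorem Suzuki2023_zetaScrew_notMemLp_holds : Suzuki2023_zetaScrew_notMemLp :=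
  ZetaScrewGrowth.zetaScrew_not_integrableOn_and_not_memLp

/-- The moments `μ_n = zetaScrewMoment n` of (1.13) are absolutely convergent integrals: the
integrand `4^{-1}e^{-t/2}Ψ(t)tⁿ` is integrable on `(0, ∞)` ("by Theorem 1.1 (3)").
[cite: Suzuki2023, (1.13), p. 3] -/
theorem integrableOn_zetaScrewMoment_integrand (n : ℕ) :
    IntegrableOn (fun t : ℝ ↦ 4⁻¹ * Real.exp (-(t / 2)) * zetaScrew t * t ^ n) (Ioi 0) :=
  ZetaScrewGrowth.integrableOn_moment_integrand n

/-- RH-CONSEQUENCE (line 1). The necessity half of `Suzuki2023_thm18` (Suzuki2023 Thm 1.8): under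
RH all Hankel determinants `det Δ_n`, `det Δ_n^{(1)}` of the moments (1.13) are `≥ 0` (for every
`n`, in particular for the printed range `n ≥ 1`). [cite: Suzuki2023, Thm 1.8 (necessity), §7.3] -/
theorem Suzuki2023_thm18_mp (hRH : RiemannHypothesis) (n : ℕ) :
    0 ≤ (zetaScrewHankel n).det ∧ 0 ≤ (zetaScrewHankelShift n).det :=
  ZetaScrewGrowth.det_zetaScrewHankel_nonneg_of_RH hRH n

/-! ### G. Thm 11.1, sufficiency: Landau's lemma for the eventually non-negative `Ψ_ω` -/

namespace ZetaScrewShiftLandau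

/-! ### Thm 11.1, sufficiency: eventual non-negativity of `Ψ_ω` forces `ξ ≠ 0` on `Re s > 1/2 + ω` -/

/-- `Ψ_ω` is continuous (each term of (11.1) is). [cite: Suzuki2023, (11.1), p. 22] -/
theorem continuous_zetaScrewShift (ω : ℝ) : Continuous (zetaScrewShift ω) := by
  have hw : Continuous fun u : ℝ ↦ Real.exp (-(ω * u)) * zetaScrew u :=
    (Real.continuous_exp.comp (continuous_const.mul continuous_id).neg).mul continuous_zetaScrew
  have h1 : Continuous fun t : ℝ ↦ Real.exp (-(ω * |t|)) * zetaScrew |t| := hw.comp continuous_abs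
  have h2 : Continuous fun t : ℝ ↦ ∫ u in (0 : ℝ)..|t|, Real.exp (-(ω * u)) * zetaScrew u :=
    (intervalIntegral.continuous_primitive (fun a b ↦ (hw.intervalIntegrable a b)) 0).comp continuous_abs
  have h3 : Continuous fun t : ℝ ↦ ∫ u in (0 : ℝ)..|t|, (|t| - u) * Real.exp (-(ω * u)) * zetaScrew u := by
    have hf : Continuous (Function.uncurry fun (x u : ℝ) ↦ (x - u) * Real.exp (-(ω * u)) * zetaScrew u) := by
      exact ((continuous_fst.sub continuous_snd).mul
        ((Real.continuous_exp.comp (continuous_const.mul continuous_snd).neg))).mul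
        (continuous_zetaScrew.comp continuous_snd)
    have := intervalIntegral.continuous_parametric_primitive_of_continuous (μ := volume) (a₀ := (0 : ℝ)) hf
    exact this.comp (continuous_abs.prodMk continuous_abs)
  unfold zetaScrewShift
  exact (h1.add (continuous_const.mul h2)).add (continuous_const.mul h3)

/-- `∫_1^∞ Ψ_ω(log x) x^{-(s+1)} dx = ∫_0^∞ Ψ_ω(t) e^{-st} dt` (the substitution `x = e^t`, as
`ZetaScrewLandau.mellinIoi_zetaScrew_log`). [cite: Suzuki2023, (11.2), p. 22] -/
theorem mellinIoi_zetaScrewShift_log (ω : ℝ) (s : ℂ) :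
    Landau.mellinIoi (fun x ↦ zetaScrewShift ω (Real.log x)) s =
      ∫ t in Ioi (0 : ℝ), (zetaScrewShift ω t : ℂ) * cexp (-s * t) := by
  unfold Landau.mellinIoi
  rw [ZetaScrewLandau.integral_Ioi_one_eq_integral_Ioi_zero]
  refine setIntegral_congr_fun measurableSet_Ioi fun t _ ↦ ?_
  dsimp only
  rw [Real.log_exp, ZetaScrewLandau.ofReal_exp_cpow, Complex.real_smul, Complex.ofReal_exp]
  have : cexp (t : ℂ) * cexp ((t : ℂ) * -(s + 1)) = cexp (-s * t) := by
    rw [← Complex.exp_add]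
    congr 1
    ring
  rw [← this]
  ring

/-- Integrability transfers likewise (real `σ`). [cite: Suzuki2023, (11.2), p. 22] -/
theorem integrableOn_zetaScrewShift_log_iff (ω σ : ℝ) :
    IntegrableOn (fun x : ℝ ↦ zetaScrewShift ω (Real.log x) * x ^ (-(σ + 1))) (Ioi 1) ↔
      IntegrableOn (fun t : ℝ ↦ zetaScrewShift ω t * Real.exp (-σ * t)) (Ioi 0) := by
  rw [ZetaScrewLandau.integrableOn_Ioi_one_iff]
  refine integrableOn_congr_fun (fun t _ ↦ ?_) measurableSet_Ioi
  rw [smul_eq_mul, Real.log_exp, Real.rpow_def_of_pos (Real.exp_pos t), Real.log_exp]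
  have : Real.exp t * Real.exp (t * -(σ + 1)) = Real.exp (-σ * t) := by
    rw [← Real.exp_add]
    congr 1
    ring
  rw [← this]
  ring

/-- (11.2) in the Laplace variable `z = is`: for `Re s > max(1/2 - ω, 0)`, `Ψ_ω(t)e^{-st} ∈ L¹(0,∞)`
and `∫₀^∞ Ψ_ω(t) e^{-st} dt = s^{-2}(ξ'/ξ)(1/2 + ω + s)`. [cite: Suzuki2023, (11.2), p. 22] -/
theorem laplace_zetaScrewShift_eq (ω : ℝ) {s : ℂ} (hs : max (1 / 2 - ω) 0 < s.re) :
    IntegrableOn (fun t : ℝ ↦ (zetaScrewShift ω t : ℂ) * cexp (-s * t)) (Ioi 0) ∧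
      ∫ t in Ioi (0 : ℝ), (zetaScrewShift ω t : ℂ) * cexp (-s * t) =
        1 / s ^ 2 * logDeriv riemannXi (1 / 2 + ω + s) := by
  have hz : max (1 / 2 - ω) 0 < (I * s).im := by simpa using hs
  obtain ⟨h1, h2⟩ := ZetaScrewShiftLaplace.laplace_zetaScrewShift ω (I * s) hz
  have hexp : ∀ t : ℝ, cexp (I * (I * s) * t) = cexp (-s * t) := by
    intro t; congr 1; rw [← mul_assoc, I_mul_I]; ring
  simp_rw [hexp] at h1 h2
  refine ⟨h1, ?_⟩
  have hI : I * (I * s) = -s := by rw [← mul_assoc, I_mul_I]; ring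
  have hs0 : s ≠ 0 := by
    intro h; rw [h, zero_re] at hs; linarith [le_max_right (1 / 2 - ω) 0]
  have hIs : (I * s) ^ 2 = -s ^ 2 := by rw [mul_pow, I_sq]; ring
  rw [h2, logDeriv_apply, hI, sub_neg_eq_add, hIs]
  field_simp

/-- For real `σ > max(1/2 - ω, 0)` the Mellin integrand `Ψ_ω(log x)x^{-(σ+1)}` is integrable on
`(1, ∞)`. [cite: Suzuki2023, (11.2), p. 22] -/
theorem integrableOn_zetaScrewShift_log_rpow (ω : ℝ) {σ : ℝ} (hσ : max (1 / 2 - ω) 0 < σ) :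
    IntegrableOn (fun x : ℝ ↦ zetaScrewShift ω (Real.log x) * x ^ (-(σ + 1))) (Ioi 1) := by
  rw [integrableOn_zetaScrewShift_log_iff]
  have h := (laplace_zetaScrewShift_eq ω (s := (σ : ℂ)) (by simpa using hσ)).1
  have hmeas : AEStronglyMeasurable (fun t : ℝ ↦ zetaScrewShift ω t * Real.exp (-σ * t))
      (volume.restrict (Ioi 0)) :=
    ((continuous_zetaScrewShift ω).mul
      (Real.continuous_exp.comp (continuous_const.mul continuous_id))).aestronglyMeasurable
  have hn : IntegrableOn (fun t : ℝ ↦ ‖(zetaScrewShift ω t : ℂ) * cexp (-(σ : ℂ) * t)‖) (Ioi 0) :=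
    h.norm
  refine (integrable_norm_iff hmeas).1 (hn.congr_fun (fun t _ ↦ ?_) measurableSet_Ioi)
  dsimp only
  rw [norm_mul, norm_mul, Complex.norm_real, Real.norm_eq_abs,
    ZetaScrewLaplace.norm_cexp_mul_ofReal, Real.norm_of_nonneg (Real.exp_pos _).le]
  simp

/-- On `Re s > max(1/2 - ω, 0)` the Mellin transform is `R_ω(s) = s^{-2}(ξ'/ξ)(1/2 + ω + s)`.
[cite: Suzuki2023, (11.2), p. 22] -/
theorem mellinIoi_eq_of_re_gt (ω : ℝ) {s : ℂ} (hs : max (1 / 2 - ω) 0 < s.re) :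
    Landau.mellinIoi (fun x ↦ zetaScrewShift ω (Real.log x)) s =
      1 / s ^ 2 * logDeriv riemannXi (1 / 2 + ω + s) := by
  rw [mellinIoi_zetaScrewShift_log, (laplace_zetaScrewShift_eq ω hs).2]

/-- `ξ(1/2 + ω + σ) ≠ 0` for real `ω`, `σ` (no real zeros of `ξ`: "the fact that `ξ(s) ≠ 0` on the
positive real line", p. 22). [cite: Suzuki2023, §11, p. 22] -/
theorem riemannXi_shift_ofReal_ne_zero (ω σ : ℝ) : riemannXi (1 / 2 + ω + σ) ≠ 0 := by
  have := ZetaScrewLandau.riemannXi_half_add_ofReal_ne_zero (ω + σ)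
  push_cast at this
  rwa [← add_assoc] at this

/-- `R_ω(s) = s^{-2}(ξ'/ξ)(1/2 + ω + s)` is differentiable at every `s ≠ 0` with `ξ(1/2 + ω + s) ≠ 0`.
[cite: Suzuki2023, (11.2), p. 22] -/
theorem differentiableAt_R (ω : ℝ) {s : ℂ} (hs0 : s ≠ 0) (hξ : riemannXi (1 / 2 + ω + s) ≠ 0) :
    DifferentiableAt ℂ (fun s : ℂ ↦ 1 / s ^ 2 * logDeriv riemannXi (1 / 2 + ω + s)) s := by
  have hlog : AnalyticAt ℂ (logDeriv riemannXi) (1 / 2 + ω + s) := by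
    have h : logDeriv riemannXi = fun z ↦ deriv riemannXi z / riemannXi z := by
      funext z; rw [logDeriv_apply]
    rw [h]
    exact (differentiable_riemannXi.analyticAt _).deriv.div (differentiable_riemannXi.analyticAt _) hξ
  have hcomp : DifferentiableAt ℂ (fun s : ℂ ↦ logDeriv riemannXi (1 / 2 + ω + s)) s :=
    hlog.differentiableAt.comp s (by fun_prop)
  refine DifferentiableAt.mul ?_ hcomp
  exact (differentiableAt_const _).div (by fun_prop) (pow_ne_zero 2 hs0)

/-- **Suzuki2023 Thm 11.1, sufficiency** ("if we use the same result of Laplace transforms as in the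
proof of Theorem 1.7": Landau's lemma, tree `Landau.integrableOn_of_differentiableOn_union_convex`,
for the EVENTUALLY non-negative `Ψ_ω(log x)`, `x > e^{t₀}`): if `Ψ_ω(t) ≥ 0` for `t ≥ t₀`, then
`ξ(1/2 + ω + w₀) ≠ 0` for every `Re w₀ > 0`. The transform converges absolutely for
`Re s > σ₀ = max(1/2 - ω, 0)` ((11.2)); `R_ω` is holomorphic on `{Re s > σ₀ + 1} ∪ W₀`, `W₀` a thin
rectangle about the zero-free real segment `[ε/2, σ₀ + 3]`, `ε = Re w₀/2`; Landau pushes the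
abscissa below every `σ > ε`; then `F(s)s²ξ(1/2+ω+s) = ξ'(1/2+ω+s)` on `Re s > ε` by the identity
theorem, and at the zero `w₀` the orders of vanishing clash (`ord ξ' + 1 = ord ξ`). [cite: Suzuki2023, Thm 11.1 and §11 p. 22 (proof sketch: (11.2) + the Laplace-transform argument of Thm 1.7)] -/
theorem riemannXi_ne_zero_of_eventually_nonneg (ω : ℝ) {t₀ : ℝ}
    (hΨ : ∀ t : ℝ, t₀ ≤ t → 0 ≤ zetaScrewShift ω t) {w₀ : ℂ} (hw₀ : 0 < w₀.re) :
    riemannXi (1 / 2 + ω + w₀) ≠ 0 := by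
  intro hzero
  set σ₀ : ℝ := max (1 / 2 - ω) 0 with hσ₀_def
  have hσ₀ : 0 ≤ σ₀ := le_max_right _ _
  set σ₁ : ℝ := σ₀ + 1 with hσ₁_def
  have hσ₁ : σ₀ < σ₁ := by rw [hσ₁_def]; linarith
  set g : ℝ → ℝ := fun x ↦ zetaScrewShift ω (Real.log x) with hg_def
  have hg : Measurable g := (continuous_zetaScrewShift ω).measurable.comp Real.measurable_log
  set R : ℂ → ℂ := fun s ↦ 1 / s ^ 2 * logDeriv riemannXi (1 / 2 + ω + s) with hR_def
  set ε : ℝ := w₀.re / 2 with hε_def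
  have hε : 0 < ε := by positivity
  -- a zero-free thin rectangle around the real segment `[ε/2, σ₁ + 2]`
  set K : Set ℂ := (fun σ : ℝ ↦ (σ : ℂ)) '' Icc (ε / 2) (σ₁ + 2) with hK_def
  have hKc : IsCompact K := isCompact_Icc.image Complex.continuous_ofReal
  set U : Set ℂ := {s : ℂ | riemannXi (1 / 2 + ω + s) ≠ 0} with hU_def
  have hUo : IsOpen U := by
    have : U = (fun s : ℂ ↦ riemannXi (1 / 2 + ω + s)) ⁻¹' {0}ᶜ := rfl
    rw [this]
    exact isOpen_compl_singleton.preimage (differentiable_riemannXi.continuous.comp (by fun_prop))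
  have hKU : K ⊆ U := by
    rintro _ ⟨σ, _, rfl⟩
    exact riemannXi_shift_ofReal_ne_zero ω σ
  obtain ⟨d₀, hd₀, hthick⟩ := hKc.exists_thickening_subset_open hUo hKU
  set W₀ : Set ℂ := {s : ℂ | ε / 2 < s.re ∧ s.re < σ₁ + 2 ∧ -d₀ < s.im ∧ s.im < d₀} with hW₀_def
  have hW₀eq : W₀ = {s : ℂ | ε / 2 < s.re} ∩ ({s : ℂ | s.re < σ₁ + 2} ∩ ({s : ℂ | -d₀ < s.im} ∩
      {s : ℂ | s.im < d₀})) := by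
    ext s; simp [hW₀_def]
  have hW₀o : IsOpen W₀ := by
    rw [hW₀eq]
    exact (isOpen_lt continuous_const Complex.continuous_re).inter
      ((isOpen_lt Complex.continuous_re continuous_const).inter
        ((isOpen_lt continuous_const Complex.continuous_im).inter
          (isOpen_lt Complex.continuous_im continuous_const)))
  have hW₀c : Convex ℝ W₀ := by
    rw [hW₀eq]
    exact (convex_halfSpace_re_gt _).inter ((convex_halfSpace_re_lt _).inter
      ((convex_halfSpace_im_gt _).inter (convex_halfSpace_im_lt _)))
  have hW₀U : W₀ ⊆ U := by
    intro s hs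
    refine hthick (Metric.mem_thickening_iff.2 ⟨(s.re : ℂ), ⟨s.re, ⟨hs.1.le, hs.2.1.le⟩, rfl⟩, ?_⟩)
    rw [dist_eq_norm]
    have : s - (s.re : ℂ) = (s.im : ℂ) * I := by
      apply Complex.ext <;> simp
    rw [this, norm_mul, Complex.norm_I, mul_one, Complex.norm_real, Real.norm_eq_abs, abs_lt]
    exact ⟨hs.2.2.1, hs.2.2.2⟩
  have hW₀r : ∀ σ : ℝ, ε < σ → σ ≤ σ₁ + 1 → (σ : ℂ) ∈ W₀ := by
    intro σ h1 h2
    simp only [hW₀_def, Set.mem_setOf_eq, ofReal_re, ofReal_im, neg_lt_zero]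
    exact ⟨by linarith, by linarith, hd₀, hd₀⟩
  -- `R` is holomorphic on `{Re s > σ₁} ∪ W₀` and agrees with the transform on `Re s > σ₁`
  have hΦ : DifferentiableOn ℂ R ({s : ℂ | σ₁ < s.re} ∪ W₀) := by
    intro s hs
    refine (differentiableAt_R ω ?_ ?_).differentiableWithinAt
    · intro h0
      rcases hs with hs | hs
      · simp only [Set.mem_setOf_eq, h0, zero_re] at hs; linarith
      · have := hs.1; rw [h0, zero_re] at this; linarith
    · rcases hs with hs | hs
      · have hs' : σ₁ < s.re := hs
        -- `Re (1/2 + ω + s) > 1/2 + ω + σ₁ ≥ 1/2 + ω + (1/2 - ω) + 1 ≥ 1`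
        refine riemannXi_ne_zero_of_one_le_re ?_
        simp only [add_re, one_div, ofReal_re]
        have : (2 : ℂ)⁻¹.re = 1 / 2 := by norm_num
        rw [this]
        have h1 : 1 / 2 - ω ≤ σ₀ := le_max_left _ _
        linarith
      · exact hW₀U hs
  have hagree : EqOn R (Landau.mellinIoi g) {s : ℂ | σ₁ < s.re} := by
    intro s hs
    simp only [Set.mem_setOf_eq] at hs
    exact (mellinIoi_eq_of_re_gt ω (by linarith)).symm
  have hint : IntegrableOn (fun x ↦ g x * x ^ (-(σ₁ + 1))) (Ioi 1) :=
    integrableOn_zetaScrewShift_log_rpow ω hσ₁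
  -- eventual non-negativity in the variable `x = e^t`
  have hX₁ : (1 : ℝ) ≤ max 1 (Real.exp t₀) := le_max_left _ _
  have hpos : ∀ x : ℝ, max 1 (Real.exp t₀) < x → 0 ≤ g x := by
    intro x hx
    have hx1 : 1 < x := lt_of_le_of_lt (le_max_left _ _) hx
    have hx0 : 0 < x := by linarith
    refine hΨ _ ?_
    have : Real.exp t₀ < x := lt_of_le_of_lt (le_max_right _ _) hx
    have := Real.log_lt_log (Real.exp_pos t₀) this
    rw [Real.log_exp] at this
    exact this.le
  have hεσ₁ : ε < σ₁ ∨ σ₁ ≤ ε := lt_or_ge ε σ₁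
  -- Landau: absolute convergence for every `σ > ε`
  have hS : ∀ σ' : ℝ, ε < σ' → IntegrableOn (fun x ↦ g x * x ^ (-(σ' + 1))) (Ioi 1) := by
    intro σ' hσ'
    rcases lt_or_ge σ' σ₁ with h | h
    · exact Landau.integrableOn_of_differentiableOn_union_convex hg hint hX₁ hpos
        (hσ'.trans h) hW₀o hW₀c hW₀r hΦ hagree hσ'
    · exact Landau.integrableOn_rpow_of_le hg h hint
  set F : ℂ → ℂ := Landau.mellinIoi g with hF_def
  have hFdiff : DifferentiableOn ℂ F {s : ℂ | ε < s.re} :=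
    Landau.differentiableOn_mellinIoi_of_forall hg hS
  set H : Set ℂ := {s : ℂ | ε < s.re} with hH_def
  have hHo : IsOpen H := isOpen_lt continuous_const Complex.continuous_re
  have hHpre : IsPreconnected H := (convex_halfSpace_re_gt ε).isPreconnected
  set Z : ℂ → ℂ := fun s ↦ riemannXi (1 / 2 + ω + s) with hZ_def
  have hZd : Differentiable ℂ Z := differentiable_riemannXi.comp (by fun_prop)
  have hZa : ∀ s, AnalyticAt ℂ Z s := fun s ↦ hZd.analyticAt s
  have hderivZ : ∀ s, deriv Z s = deriv riemannXi (1 / 2 + ω + s) := fun s ↦ by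
    simp only [hZ_def]
    exact deriv_comp_const_add riemannXi (1 / 2 + ω) s
  set G : ℂ → ℂ := fun s ↦ F s * s ^ 2 with hG_def
  have hGa : ∀ s ∈ H, AnalyticAt ℂ G s := fun s hs ↦
    ((hFdiff.analyticOnNhd hHo) s hs).mul ((analyticAt_id.pow 2))
  have hf₁ : AnalyticOnNhd ℂ (G * Z) H := fun s hs ↦ (hGa s hs).mul (hZa s)
  have hf₂ : AnalyticOnNhd ℂ (deriv Z) H := fun s _ ↦ (hZa s).deriv
  -- agreement near the real point `σ₁ + ε + 1`
  set p₀ : ℂ := ((σ₁ + ε + 1 : ℝ) : ℂ) with hp₀_def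
  have hp₀H : p₀ ∈ H := by simp [hH_def, hp₀_def]; linarith
  have hev2 : (G * Z) =ᶠ[𝓝 p₀] deriv Z := by
    have hopen : IsOpen {s : ℂ | σ₁ < s.re} := isOpen_lt continuous_const Complex.continuous_re
    have hp₀1 : p₀ ∈ {s : ℂ | σ₁ < s.re} := by simp [hp₀_def]; linarith
    filter_upwards [hopen.mem_nhds hp₀1] with s hs
    have hs' : σ₁ < s.re := hs
    have hξ : riemannXi (1 / 2 + ω + s) ≠ 0 := by
      refine riemannXi_ne_zero_of_one_le_re ?_
      simp only [add_re, one_div, ofReal_re]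
      have : (2 : ℂ)⁻¹.re = 1 / 2 := by norm_num
      rw [this]
      have h1 : 1 / 2 - ω ≤ σ₀ := le_max_left _ _
      linarith
    have hs0 : s ≠ 0 := fun h ↦ by rw [h, zero_re] at hs'; linarith
    rw [Pi.mul_apply, hderivZ s]
    simp only [hG_def, hZ_def]
    rw [← hagree hs]
    simp only [hR_def]
    rw [logDeriv_apply]
    set A : ℂ := deriv riemannXi (1 / 2 + ω + s)
    set B : ℂ := riemannXi (1 / 2 + ω + s)
    field_simp
  have hEqOn : EqOn (G * Z) (deriv Z) H := hf₁.eqOn_of_preconnected_of_eventuallyEq hf₂ hHpre hp₀H hev2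
  -- orders at `w₀`
  have hw₀H : w₀ ∈ H := by simp [hH_def, hε_def]; linarith
  have hev : deriv Z =ᶠ[𝓝 w₀] G * Z := by
    filter_upwards [hHo.mem_nhds hw₀H] with s hs
    exact (hEqOn hs).symm
  have hZ0 : Z w₀ = 0 := hzero
  have h1 : analyticOrderAt (deriv Z) w₀ + 1 = analyticOrderAt Z w₀ := by
    have := (hZa w₀).analyticOrderAt_deriv_add_one
    simpa [hZ0] using this
  have h2 : analyticOrderAt (deriv Z) w₀ = analyticOrderAt G w₀ + analyticOrderAt Z w₀ := by
    rw [analyticOrderAt_congr hev, analyticOrderAt_mul (hGa w₀ hw₀H) (hZa w₀)]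
  rw [h2] at h1
  generalize hoZ : analyticOrderAt Z w₀ = oZ at h1
  generalize hoG : analyticOrderAt G w₀ = oG at h1
  cases oZ with
  | top =>
    have hloc : ∀ᶠ s in 𝓝 w₀, Z s = 0 := analyticOrderAt_eq_top.1 hoZ
    have hall : EqOn Z 0 univ :=
      (hZd.differentiableOn.analyticOnNhd isOpen_univ).eqOn_zero_of_preconnected_of_eventuallyEq_zero
        isPreconnected_univ (Set.mem_univ w₀) hloc
    have h1' : Z ((σ₁ : ℂ)) = 0 := hall (Set.mem_univ _)
    simp only [hZ_def] at h1'
    exact riemannXi_shift_ofReal_ne_zero ω σ₁ h1'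
  | coe n =>
    cases oG with
    | top => simp at h1
    | coe m =>
      have h' : (m + n + 1 : ℕ) = n := by exact_mod_cast h1
      omega

/-- RH-FREE (the door direction of the graded family). **Suzuki2023 Thm 11.1, `⟸`, as a theorem**:
if `Ψ_ω(t) ≥ 0` for all `t ≥ t₀` (some `t₀ > 0`), then `ξ(s) ≠ 0` for `Re s > 1/2 + ω` — the right-to-left
implication of the named fact `Suzuki2023_thm111` at every `ω` (the left-to-right one, via
[KrLa77], is not proved here). [cite: Suzuki2023, Thm 11.1 and §11 p. 22 (proof sketch: (11.2) + the Laplace-transform argument of Thm 1.7)] -/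
theorem riemannXi_ne_zero_of_zetaScrewShift_eventually_nonneg (ω : ℝ)
    (h : ∃ t₀ : ℝ, 0 < t₀ ∧ ∀ t : ℝ, t₀ ≤ t → 0 ≤ zetaScrewShift ω t) :
    ∀ s : ℂ, 1 / 2 + ω < s.re → riemannXi s ≠ 0 := by
  obtain ⟨t₀, -, hΨ⟩ := h
  intro s hs
  have hw : 0 < (s - (1 / 2 + ω)).re := by
    simp only [sub_re, add_re, one_div, ofReal_re]
    have : (2 : ℂ)⁻¹.re = 1 / 2 := by norm_num
    rw [this]; linarith
  have := riemannXi_ne_zero_of_eventually_nonneg ω hΨ hw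
  rwa [show (1 : ℂ) / 2 + ω + (s - (1 / 2 + ω)) = s by ring] at this

/-- RH-FREE door at `ω = 0`: **RH follows from EVENTUAL non-negativity of `Ψ`** (`Ψ(t) ≥ 0` for
`t ≥ t₀`), the `ω = 0`, `⟸` case of Thm 11.1 ("seemingly milder" than Thm 1.7's hypothesis `Ψ ≥ 0`
on all of `ℝ`, tree `riemannHypothesis_of_zetaScrew_nonneg`); `Ψ_0 = Ψ` by
`zetaScrewShift_zero_left`. WHAT THIS IS NOT: nobody has shown `Ψ` is eventually non-negative;
this fixes WHICH sign condition implies RH. [cite: Suzuki2023, Thm 11.1 (ω = 0) and Thm 1.7] -/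
theorem riemannHypothesis_of_zetaScrew_eventually_nonneg
    (h : ∃ t₀ : ℝ, 0 < t₀ ∧ ∀ t : ℝ, t₀ ≤ t → 0 ≤ zetaScrew t) : RiemannHypothesis := by
  have h' : ∃ t₀ : ℝ, 0 < t₀ ∧ ∀ t : ℝ, t₀ ≤ t → 0 ≤ zetaScrewShift 0 t := by
    obtain ⟨t₀, ht₀, hΨ⟩ := h
    exact ⟨t₀, ht₀, fun t ht ↦ by rw [zetaScrewShift_zero_left]; exact hΨ t ht⟩
  have hne := riemannXi_ne_zero_of_zetaScrewShift_eventually_nonneg 0 h'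
  refine quasiRiemannHypothesis_one_half_iff_holds.1 fun s hs h1 h2 ↦ ?_
  have hξ : riemannXi s = 0 := (riemannXi_eq_zero_iff_holds s).2 ⟨hs, by linarith, h2⟩
  exact hne s (by simpa using h1) hξ

end ZetaScrewShiftLandau

/-- **Discharge of `Suzuki2023_eq112`** (Suzuki2023 (11.2): the one-sided Fourier transform of
`Ψ_ω`, on `Im z > max(1/2 - ω, 0)`). [cite: Suzuki2023, (11.2), p. 22] -/
theorem Suzuki2023_eq112_holds : Suzuki2023_eq112 :=
  ZetaScrewShiftLaplace.laplace_zetaScrewShift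

/-- RH-FREE. **Suzuki2023 Thm 11.1, the `⟸` direction, proved for every `ω`**: eventual
non-negativity of `Ψ_ω` implies `ξ(s) ≠ 0` for `Re s > 1/2 + ω` (half of the named fact
`Suzuki2023_thm111`; the `⟹` direction needs the Kreĭn–Langer correspondence and is not in the
tree). [cite: Suzuki2023, Thm 11.1 and §11 p. 22 (proof sketch: (11.2) + the Laplace-transform argument of Thm 1.7)] -/
theorem Suzuki2023_thm111_mpr (ω : ℝ)
    (h : ∃ t₀ : ℝ, 0 < t₀ ∧ ∀ t : ℝ, t₀ ≤ t → 0 ≤ zetaScrewShift ω t) :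
    ∀ s : ℂ, 1 / 2 + ω < s.re → riemannXi s ≠ 0 :=
  ZetaScrewShiftLandau.riemannXi_ne_zero_of_zetaScrewShift_eventually_nonneg ω h

/-- RH-FREE door (line 1). **RH from eventual non-negativity of `Ψ`** (Suzuki2023 Thm 11.1 at
`ω = 0`, `⟸`): `(∃ t₀ > 0, ∀ t ≥ t₀, Ψ(t) ≥ 0) → RH`. [cite: Suzuki2023, Thm 11.1 (ω = 0)] -/
theorem riemannHypothesis_of_zetaScrew_eventually_nonneg
    (h : ∃ t₀ : ℝ, 0 < t₀ ∧ ∀ t : ℝ, t₀ ≤ t → 0 ≤ zetaScrew t) : RiemannHypothesis :=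
  ZetaScrewShiftLandau.riemannHypothesis_of_zetaScrew_eventually_nonneg h

/-- RH-FREE. **Suzuki2023 (1.15)**: `μ_n = dⁿ/dXⁿ[(1-2X)^{-2}(ξ'/ξ)(1-X)]_{X=0}` (`μ_n = zetaScrewMoment n`,
`ξ = riemannXi`; the analytic input of the moment/Li-coefficient relations of Thm 8.1).
[cite: Suzuki2023, (1.15), p. 4] -/
theorem zetaScrewMoment_eq_iteratedDeriv (n : ℕ) :
    (zetaScrewMoment n : ℂ) =
      iteratedDeriv n
        (fun X : ℂ ↦ 1 / (1 - 2 * X) ^ 2 * (deriv riemannXi (1 - X) / riemannXi (1 - X))) 0 :=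
  ZetaScrewMomentDeriv.zetaScrewMoment_eq_iteratedDeriv n

/-! ### I. Thm 8.1 and Thm 8.2: the Li coefficients and the moments -/

namespace ZetaScrewLiMoments

open Finset

/-! ### I.1 The two expansions at `s = 1`: `e_j = (log ξ)^{(j)}(1)` -/

/-- `(log ξ)' = ξ'/ξ` near `s = 1` (`ξ(1) = 1/2 > 0`, principal branch). [cite: Suzuki2023, (1.14)–(1.15), p. 4] -/
theorem deriv_log_riemannXi_eventuallyEq :
    deriv (fun s : ℂ ↦ Complex.log (riemannXi s)) =ᶠ[𝓝 1]
      fun s ↦ deriv riemannXi s / riemannXi s := by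
  have hslit : ∀ᶠ s : ℂ in 𝓝 1, riemannXi s ∈ Complex.slitPlane := by
    have hc : ContinuousAt riemannXi 1 := differentiable_riemannXi.continuous.continuousAt
    have h1 : riemannXi 1 ∈ Complex.slitPlane := by
      rw [riemannXi_one, Complex.mem_slitPlane_iff]; norm_num
    exact hc.preimage_mem_nhds (Complex.isOpen_slitPlane.mem_nhds h1)
  filter_upwards [hslit] with s hs
  exact ((differentiable_riemannXi s).hasDerivAt.clog hs).deriv

/-- `dᵏ/dsᵏ[ξ'/ξ](1) = (log ξ)^{(k+1)}(1)`. [cite: Suzuki2023, (1.14)–(1.15), p. 4] -/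
theorem iteratedDeriv_logDerivXi_one (k : ℕ) :
    iteratedDeriv k (fun s : ℂ ↦ deriv riemannXi s / riemannXi s) 1 =
      iteratedDeriv (k + 1) (fun s : ℂ ↦ Complex.log (riemannXi s)) 1 := by
  rw [iteratedDeriv_succ']
  exact (deriv_log_riemannXi_eventuallyEq.iteratedDeriv_eq k).symm

/-- The factor `g(X) = (ξ'/ξ)(1 - X)` of (1.15): `g^{(k)}(0) = (-1)^k (log ξ)^{(k+1)}(1)`.
[cite: Suzuki2023, (1.15), p. 4] -/
theorem iteratedDeriv_g (k : ℕ) :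
    iteratedDeriv k (fun X : ℂ ↦ deriv riemannXi (1 - X) / riemannXi (1 - X)) 0 =
      (-1) ^ k * iteratedDeriv (k + 1) (fun s : ℂ ↦ Complex.log (riemannXi s)) 1 := by
  have h := congrFun (iteratedDeriv_comp_const_sub k
    (fun s : ℂ ↦ deriv riemannXi s / riemannXi s) 1) 0
  simp only [sub_zero, smul_eq_mul] at h
  rw [h, iteratedDeriv_logDerivXi_one]

/-- `g` is analytic at `0` (`ξ(1) ≠ 0`). [cite: Suzuki2023, (1.15), p. 4] -/
theorem analyticAt_g :
    AnalyticAt ℂ (fun X : ℂ ↦ deriv riemannXi (1 - X) / riemannXi (1 - X)) 0 := by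
  have hsub : AnalyticAt ℂ (fun X : ℂ ↦ (1 : ℂ) - X) 0 := analyticAt_const.sub analyticAt_id
  have h2 : AnalyticAt ℂ (fun X : ℂ ↦ deriv riemannXi (1 - X)) 0 :=
    ((differentiable_riemannXi.analyticAt _).deriv).comp hsub
  have h3 : AnalyticAt ℂ (fun X : ℂ ↦ riemannXi (1 - X)) 0 :=
    (differentiable_riemannXi.analyticAt _).comp hsub
  refine h2.div h3 ?_
  simp [riemannXi_one]

/-- The factor `f(X) = (1-2X)^{-2}` of (1.15) is analytic at `0`. [cite: Suzuki2023, (1.15), p. 4] -/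
theorem analyticAt_f : AnalyticAt ℂ (fun X : ℂ ↦ 1 / (1 - 2 * X) ^ 2) 0 :=
  analyticAt_const.div ((analyticAt_const.sub (analyticAt_const.mul analyticAt_id)).pow 2)
    (by norm_num)

/-- `R(X) = (1-2X)^{-2}(ξ'/ξ)(1-X)` is analytic at `0`. [cite: Suzuki2023, (1.15), p. 4] -/
theorem analyticAt_R :
    AnalyticAt ℂ (fun X : ℂ ↦ 1 / (1 - 2 * X) ^ 2 * (deriv riemannXi (1 - X) / riemannXi (1 - X))) 0 :=
  ZetaScrewMomentDeriv.analyticOnNhd_R 0 ⟨by simp [riemannXi_one], by norm_num⟩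

/-- `f^{(i)}(0) = (i+1)!·2^i` (`(1-2X)^{-2} = ∑ (k+1)2^k X^k`; here via `f = ((-2X+1)^{-1}/2)'`).
[cite: Suzuki2023, (1.15), p. 4] -/
theorem iteratedDeriv_f (i : ℕ) :
    iteratedDeriv i (fun X : ℂ ↦ 1 / (1 - 2 * X) ^ 2) 0 = ((i + 1)! : ℂ) * 2 ^ i := by
  set h : ℂ → ℂ := fun X ↦ (1 / 2 : ℂ) * (-2 * X + 1)⁻¹ with hh
  have hev : (fun X : ℂ ↦ 1 / (1 - 2 * X) ^ 2) =ᶠ[𝓝 0] deriv h := by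
    have hopen : IsOpen {X : ℂ | -2 * X + 1 ≠ 0} := isOpen_ne_fun (by fun_prop) (by fun_prop)
    have h0 : (0 : ℂ) ∈ {X : ℂ | -2 * X + 1 ≠ 0} := by simp
    filter_upwards [hopen.mem_nhds h0] with X hX
    have h1 : HasDerivAt (fun x : ℂ ↦ -2 * x + 1) (-2) X := by
      simpa using ((hasDerivAt_id X).const_mul (-2 : ℂ)).add_const (1 : ℂ)
    have h2 := (h1.fun_inv hX).const_mul (1 / 2 : ℂ)
    rw [h2.deriv]
    have : (-2 * X + 1) = (1 - 2 * X) := by ring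
    rw [this]
    ring
  rw [hev.iteratedDeriv_eq, ← iteratedDeriv_succ', hh, iteratedDeriv_const_mul_field,
    iteratedDeriv_eq_iterate, iter_deriv_inv_linear]
  simp only [mul_zero, zero_add, one_zpow, mul_one]
  rw [show ((-1 : ℂ)) ^ (i + 1) * ((i + 1)! : ℂ) * (-2) ^ (i + 1) =
      ((i + 1)! : ℂ) * ((-1) * (-2)) ^ (i + 1) by rw [mul_pow]; ring]
  norm_num
  ring

/-- **(1.15) expanded at `s = 1`** (Leibniz): `μ_n = ∑_i C(n,i)(i+1)!2^i (-1)^{n-i} e_{n-i+1}` with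
`e_j = (log ξ)^{(j)}(1)`. [cite: Suzuki2023, (1.15), p. 4; Thm 8.1 (proof, "comparing (1.14) and (1.15)")] -/
theorem moment_eq_sum_e (n : ℕ) :
    (zetaScrewMoment n : ℂ) = ∑ i ∈ range (n + 1),
      (n.choose i : ℂ) * (((i + 1)! : ℂ) * 2 ^ i) *
        ((-1) ^ (n - i) * iteratedDeriv (n - i + 1) (fun s : ℂ ↦ Complex.log (riemannXi s)) 1) := by
  rw [zetaScrewMoment_eq_iteratedDeriv,
    show (fun X : ℂ ↦ 1 / (1 - 2 * X) ^ 2 * (deriv riemannXi (1 - X) / riemannXi (1 - X))) =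
      fun X ↦ (fun X : ℂ ↦ 1 / (1 - 2 * X) ^ 2) X *
        (fun X : ℂ ↦ deriv riemannXi (1 - X) / riemannXi (1 - X)) X from rfl,
    iteratedDeriv_fun_mul analyticAt_f.contDiffAt analyticAt_g.contDiffAt]
  refine Finset.sum_congr rfl fun i _ ↦ ?_
  rw [iteratedDeriv_f, iteratedDeriv_g]

/-- The inverse polynomial `p(X) = (1-2X)²` of the factor `(1-2X)^{-2}` in (1.15): its derivatives at
`0` are `1, -4, 8, 0, 0, …`. [cite: Suzuki2023, (1.15), p. 4] -/
theorem iteratedDeriv_p (i : ℕ) :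
    iteratedDeriv i (fun X : ℂ ↦ (1 - 2 * X) ^ 2) 0 =
      if i = 0 then 1 else if i = 1 then -4 else if i = 2 then 8 else 0 := by
  have hd1 : deriv (fun X : ℂ ↦ (1 - 2 * X) ^ 2) = fun X ↦ 8 * X - 4 := by
    funext X
    have h1 : HasDerivAt (fun x : ℂ ↦ 1 - 2 * x) (-2) X := by
      simpa using ((hasDerivAt_id X).const_mul (2 : ℂ)).const_sub (1 : ℂ)
    have h2 : HasDerivAt (fun x : ℂ ↦ (1 - 2 * x) ^ 2) (((2 : ℕ) : ℂ) * (1 - 2 * X) ^ (2 - 1) * (-2)) X :=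
      h1.pow 2
    rw [h2.deriv]
    push_cast
    ring
  have hd2 : deriv (fun X : ℂ ↦ 8 * X - 4) = fun _ ↦ 8 := by
    funext X
    have h1 : HasDerivAt (fun x : ℂ ↦ 8 * x - 4) 8 X := by
      simpa using ((hasDerivAt_id X).const_mul (8 : ℂ)).sub_const (4 : ℂ)
    exact h1.deriv
  rcases i with _ | _ | _ | i
  · simp
  · simp [hd1]
  · simp [iteratedDeriv_succ', hd1, hd2]
  · simp only [iteratedDeriv_succ', hd1, hd2, deriv_const']
    simp

/-- **(1.15) read backwards**: `g = p · R` near `0`, so `(-1)^k e_{k+1} = μ_k - 4kμ_{k-1} + 4k(k-1)μ_{k-2}`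
(the terms with `ℕ`-subtracted indices carry the vanishing factors `k`, `k(k-1)` when `k < 2`).
[cite: Suzuki2023, (1.15), p. 4; Thm 8.1] -/
theorem e_succ_eq (k : ℕ) :
    (-1) ^ k * iteratedDeriv (k + 1) (fun s : ℂ ↦ Complex.log (riemannXi s)) 1 =
      (zetaScrewMoment k : ℂ) - 4 * k * (zetaScrewMoment (k - 1) : ℂ) +
        4 * k * ((k : ℂ) - 1) * (zetaScrewMoment (k - 2) : ℂ) := by
  -- `g = p · R` near `0`
  have hev : (fun X : ℂ ↦ deriv riemannXi (1 - X) / riemannXi (1 - X)) =ᶠ[𝓝 0]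
      fun X ↦ (fun X : ℂ ↦ (1 - 2 * X) ^ 2) X *
        (fun X : ℂ ↦ 1 / (1 - 2 * X) ^ 2 * (deriv riemannXi (1 - X) / riemannXi (1 - X))) X := by
    have hopen : IsOpen {X : ℂ | 1 - 2 * X ≠ 0} := isOpen_ne_fun (by fun_prop) (by fun_prop)
    have h0 : (0 : ℂ) ∈ {X : ℂ | 1 - 2 * X ≠ 0} := by simp
    filter_upwards [hopen.mem_nhds h0] with X hX
    rw [← mul_assoc, mul_one_div_cancel (pow_ne_zero 2 hX), one_mul]
  rw [← iteratedDeriv_g, hev.iteratedDeriv_eq,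
    iteratedDeriv_fun_mul (by fun_prop) analyticAt_R.contDiffAt]
  simp only [iteratedDeriv_p, ← zetaScrewMoment_eq_iteratedDeriv]
  -- only `i = 0, 1, 2` survive
  rcases k with _ | _ | k
  · simp
  · simp [Finset.sum_range_succ]
    ring
  · rw [Finset.sum_range_succ', Finset.sum_range_succ', Finset.sum_range_succ']
    rw [Finset.sum_eq_zero (fun i _ ↦ by simp)]
    simp only [Nat.choose_zero_right, Nat.choose_one_right, Nat.cast_one, zero_add]
    have h2 : ((k + 2).choose 2 : ℂ) = (k + 2) * (k + 1) / 2 := by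
      rw [Nat.cast_choose ℂ (by omega : 2 ≤ k + 2), show k + 2 - 2 = k from by omega,
        Nat.factorial_succ, Nat.factorial_succ]
      have hk : (k ! : ℂ) ≠ 0 := by exact_mod_cast Nat.factorial_ne_zero k
      push_cast
      field_simp
      ring
    simp [h2]
    ring

/-! ### I.2 Keiper's formula (the definition of `λ_n`) expanded at `s = 1` -/

/-- **(1.14) at `s = 1`** (Leibniz on Keiper's `dⁿ/dsⁿ[s^{n-1} log ξ(s)]`, the tree's definition of
`keiperLiCoeff`): `dⁿ/dsⁿ[s^{n-1}log ξ(s)](1) = ∑_i C(n,i)·(n-1)^{(i)}·e_{n-i}`.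
[cite: Suzuki2023, (1.14), p. 4; Li1997, (1.1)] -/
theorem keiper_eq_sum_e (n : ℕ) :
    iteratedDeriv n (fun s : ℂ ↦ s ^ (n - 1) * Complex.log (riemannXi s)) 1 =
      ∑ i ∈ range (n + 1), (n.choose i : ℂ) * ((n - 1).descFactorial i : ℂ) *
        iteratedDeriv (n - i) (fun s : ℂ ↦ Complex.log (riemannXi s)) 1 := by
  rw [show (fun s : ℂ ↦ s ^ (n - 1) * Complex.log (riemannXi s)) =
      fun s ↦ (fun s : ℂ ↦ s ^ (n - 1)) s * (fun s : ℂ ↦ Complex.log (riemannXi s)) s from rfl,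
    iteratedDeriv_fun_mul (by fun_prop : ContDiffAt ℂ n (fun s : ℂ ↦ s ^ (n - 1)) 1)
      analyticAt_log_riemannXi_one.contDiffAt]
  refine Finset.sum_congr rfl fun i _ ↦ ?_
  rw [show (fun s : ℂ ↦ s ^ (n - 1)) = (· ^ (n - 1)) from rfl, iteratedDeriv_pow]
  simp

/-- Normalised form of (1.14) at `s = 1`: with `F_j = e_{j+1}/j!`,
`(1/N!)·d^{N+1}/ds^{N+1}[s^N log ξ(s)](1) = ∑_{j ≤ N} C(N+1, j+1) F_j` (`= λ_{N+1}` after `re`).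
[cite: Suzuki2023, (1.14), p. 4] -/
theorem keiper_div_factorial_eq (N : ℕ) :
    iteratedDeriv (N + 1) (fun s : ℂ ↦ s ^ (N + 1 - 1) * Complex.log (riemannXi s)) 1 / (N ! : ℂ) =
      ∑ j ∈ range (N + 1), ((N + 1).choose (j + 1) : ℂ) *
        (iteratedDeriv (j + 1) (fun s : ℂ ↦ Complex.log (riemannXi s)) 1 / (j ! : ℂ)) := by
  rw [keiper_eq_sum_e, Finset.sum_range_succ, show N + 1 - 1 = N from rfl,
    (Nat.descFactorial_eq_zero_iff_lt.2 (Nat.lt_succ_self N)), Nat.cast_zero, mul_zero, zero_mul,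
    add_zero, Finset.sum_div]
  refine Finset.sum_nbij' (fun i ↦ N - i) (fun j ↦ N - j)
    (fun i hi ↦ by simp only [Finset.mem_range] at hi ⊢; omega)
    (fun j hj ↦ by simp only [Finset.mem_range] at hj ⊢; omega)
    (fun i hi ↦ by simp only [Finset.mem_range] at hi ⊢; omega)
    (fun j hj ↦ by simp only [Finset.mem_range] at hj ⊢; omega) (fun i hi ↦ ?_)
  simp only [Finset.mem_range] at hi
  have hi' : i ≤ N := Nat.lt_succ_iff.1 hi
  have hN : (N ! : ℂ) = ((N - i)! : ℂ) * (N.descFactorial i : ℂ) := by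
    exact_mod_cast (Nat.factorial_mul_descFactorial hi').symm
  have hne : ((N - i)! : ℂ) ≠ 0 := by exact_mod_cast Nat.factorial_ne_zero _
  have hne' : (N.descFactorial i : ℂ) ≠ 0 := by
    exact_mod_cast (fun h ↦ absurd (Nat.descFactorial_eq_zero_iff_lt.1 h) (not_lt.2 hi'))
  rw [show N - i + 1 = N + 1 - i from by omega,
    show (N + 1).choose (N + 1 - i) = (N + 1).choose i from Nat.choose_symm (by omega), hN]
  field_simp

/-! ### I.3 Finite-sum bookkeeping -/

/-- Binomial inversion (the "inductive procedure" behind Suzuki2023 (8.8)): if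
`L_j = ∑_{l ≤ j} C(j+1, l+1) F_l` for all `j`, then `F_k = ∑_{j ≤ k} (-1)^{k-j} C(k+1, j+1) L_j`.
[cite: Suzuki2023, (8.8), p. 18] -/
theorem binomial_inversion {R : Type*} [CommRing R] (F L : ℕ → R)
    (h : ∀ j, L j = ∑ l ∈ range (j + 1), ((j + 1).choose (l + 1) : R) * F l) (k : ℕ) :
    F k = ∑ j ∈ range (k + 1), (-1) ^ (k - j) * ((k + 1).choose (j + 1) : R) * L j := by
  simp_rw [h, Finset.mul_sum]
  rw [Finset.sum_comm' (t' := range (k + 1)) (s' := fun l ↦ Finset.Ico l (k + 1))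
    (fun j l ↦ by simp only [Finset.mem_range, Finset.mem_Ico]; omega)]
  -- inner sums: `∑_{j ∈ [l, k]} (-1)^{k-j} C(k+1,j+1) C(j+1,l+1) = C(k+1,l+1)·[l = k]`
  have inner : ∀ l ∈ range (k + 1),
      ∑ j ∈ Finset.Ico l (k + 1), (-1) ^ (k - j) * ((k + 1).choose (j + 1) : R) *
        (((j + 1).choose (l + 1) : R) * F l) = if l = k then F k else 0 := by
    intro l hl
    simp only [Finset.mem_range] at hl
    have hlk : l ≤ k := Nat.lt_succ_iff.1 hl
    have hterm : ∀ j ∈ Finset.Ico l (k + 1),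
        (-1) ^ (k - j) * ((k + 1).choose (j + 1) : R) * (((j + 1).choose (l + 1) : R) * F l) =
          ((k + 1).choose (l + 1) : R) * F l * ((-1) ^ (k - j) * ((k - l).choose (j - l) : R)) := by
      intro j hj
      simp only [Finset.mem_Ico] at hj
      have hc := Nat.choose_mul (n := k + 1) (k := j + 1) (s := l + 1) (by omega)
      have hc' : ((k + 1).choose (j + 1) : R) * ((j + 1).choose (l + 1) : R) =
          ((k + 1).choose (l + 1) : R) * ((k - l).choose (j - l) : R) := by
        rw [show k + 1 - (l + 1) = k - l from by omega, show j + 1 - (l + 1) = j - l from by omega] at hc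
        have hc2 := congrArg (Nat.cast : ℕ → R) hc
        push_cast at hc2
        exact hc2
      linear_combination ((-1 : R) ^ (k - j) * F l) * hc'
    rw [Finset.sum_congr rfl hterm, ← Finset.mul_sum, Finset.sum_Ico_eq_sum_range,
      show k + 1 - l = (k - l) + 1 from by omega]
    have halt : ∑ i ∈ range (k - l + 1), (-1 : R) ^ (k - (l + i)) * ((k - l).choose (l + i - l) : R) =
        if k - l = 0 then 1 else 0 := by
      have h1 : ∑ i ∈ range (k - l + 1), (-1 : R) ^ (k - (l + i)) * ((k - l).choose (l + i - l) : R) =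
          ∑ i ∈ range (k - l + 1), (-1 : R) ^ i * ((k - l).choose i : R) := by
        rw [← Finset.sum_range_reflect]
        refine Finset.sum_congr rfl fun i hi ↦ ?_
        simp only [Finset.mem_range] at hi
        rw [show k - (l + (k - l + 1 - 1 - i)) = i from by omega,
          show l + (k - l + 1 - 1 - i) - l = (k - l) - i from by omega,
          Nat.choose_symm (by omega)]
      rw [h1]
      have h2 := congrArg (Int.cast : ℤ → R) (Int.alternating_sum_range_choose (n := k - l))
      push_cast at h2
      rw [h2]
    rw [halt]
    by_cases hl' : l = k
    · subst hl'; simp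
    · have : k - l ≠ 0 := by omega
      simp [hl', this]
  rw [Finset.sum_congr rfl inner]
  simp

/-- Regrouping a sum against a three-term recurrence ("grouping the right-hand side concerning
moments `μ_k`"): the shifted terms are re-indexed, the boundary terms vanish.
[cite: Suzuki2023, proof of Thm 8.2, p. 19] -/
theorem sum_three_term_regroup {R : Type*} [CommRing R] (u v w x : ℕ → R) (M : ℕ)
    (hv0 : v 0 = 0) (hw0 : w 0 = 0) (hw1 : w 1 = 0) (hvM : v M = 0) (hwM : w M = 0)
    (hwM1 : w (M + 1) = 0) :
    ∑ j ∈ range M, (u j * x j + v j * x (j - 1) + w j * x (j - 2)) =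
      ∑ k ∈ range M, (u k + v (k + 1) + w (k + 2)) * x k := by
  have h1 : ∑ j ∈ range M, v j * x (j - 1) = ∑ k ∈ range M, v (k + 1) * x k := by
    rcases M with _ | M
    · simp
    · rw [Finset.sum_range_succ', Finset.sum_range_succ, hv0, hvM]
      simp
  have h2 : ∑ j ∈ range M, w j * x (j - 2) = ∑ k ∈ range M, w (k + 2) * x k := by
    rcases M with _ | _ | M
    · simp
    · simp [hw0, hwM1]
    · rw [Finset.sum_range_succ', Finset.sum_range_succ', Finset.sum_range_succ,
        Finset.sum_range_succ, hw0, hw1, hwM, show M + 2 + 1 = M + 3 from rfl, hwM1]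
      simp
  simp only [Finset.sum_add_distrib, add_mul]
  rw [h1, h2]

/-- Signs: `(-1)^a (-1)^{a-j} = (-1)^j` for `j ≤ a`. [folklore] -/
private theorem neg_one_pow_mul_neg_one_pow_sub {R : Type*} [CommRing R] {a j : ℕ} (h : j ≤ a) :
    (-1 : R) ^ a * (-1) ^ (a - j) = (-1) ^ j := by
  obtain ⟨d, rfl⟩ := Nat.exists_eq_add_of_le h
  rw [Nat.add_sub_cancel_left, pow_add, mul_assoc, ← pow_add, ← two_mul, pow_mul]
  norm_num

/-! ### I.4 Thm 8.1, (8.3): the moments in terms of the Li coefficients -/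

/-- **(8.3) over `ℂ`** (range-indexed): with `Λ_{j+1} = (1/j!)·d^{j+1}/ds^{j+1}[s^j log ξ(s)](1)`
(whose real part is `λ_{j+1}`),
`μ_n/n! = ∑_{j ≤ n} [∑_{i ≤ n-j} (i+1)2^i C(n+1-i, j+1)] (-1)^j Λ_{j+1}`.
Road: (1.15) at `s = 1` (`moment_eq_sum_e`), binomial inversion of (1.14) at `s = 1`
(`keiper_div_factorial_eq`), and one exchange of summations — in place of the printed zero-sum
computation (8.6)–(8.8). [cite: Suzuki2023, Thm 8.1 (8.3), p. 18] -/
theorem moment_div_factorial_eq (n : ℕ) :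
    (zetaScrewMoment n : ℂ) / (n ! : ℂ) =
      ∑ j ∈ range (n + 1),
        ((∑ i ∈ range (n + 1 - j), ((i : ℂ) + 1) * 2 ^ i * ((n + 1 - i).choose (j + 1) : ℂ)) *
          (-1) ^ j) *
          (iteratedDeriv (j + 1) (fun s : ℂ ↦ s ^ (j + 1 - 1) * Complex.log (riemannXi s)) 1 /
            (j ! : ℂ)) := by
  set E : ℕ → ℂ := fun j ↦ iteratedDeriv j (fun s : ℂ ↦ Complex.log (riemannXi s)) 1 with hE
  set F : ℕ → ℂ := fun l ↦ E (l + 1) / (l ! : ℂ) with hF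
  set L : ℕ → ℂ := fun j ↦
    iteratedDeriv (j + 1) (fun s : ℂ ↦ s ^ (j + 1 - 1) * Complex.log (riemannXi s)) 1 / (j ! : ℂ)
    with hL
  have hLF : ∀ j, L j = ∑ l ∈ range (j + 1), ((j + 1).choose (l + 1) : ℂ) * F l := fun j ↦
    keiper_div_factorial_eq j
  have hinv := binomial_inversion F L hLF
  -- step 1: `μ_n/n! = ∑_i (i+1) 2^i (-1)^{n-i} F_{n-i}`
  have h1 : (zetaScrewMoment n : ℂ) / (n ! : ℂ) =
      ∑ i ∈ range (n + 1), ((i : ℂ) + 1) * 2 ^ i * ((-1) ^ (n - i) * F (n - i)) := by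
    rw [moment_eq_sum_e, Finset.sum_div]
    refine Finset.sum_congr rfl fun i hi ↦ ?_
    simp only [Finset.mem_range] at hi
    have hi' : i ≤ n := Nat.lt_succ_iff.1 hi
    have hfac : (n ! : ℂ) = (n.choose i : ℂ) * (i ! : ℂ) * ((n - i)! : ℂ) := by
      exact_mod_cast (Nat.choose_mul_factorial_mul_factorial hi').symm
    have hne1 : (i ! : ℂ) ≠ 0 := by exact_mod_cast Nat.factorial_ne_zero _
    have hne2 : ((n - i)! : ℂ) ≠ 0 := by exact_mod_cast Nat.factorial_ne_zero _
    have hne3 : (n.choose i : ℂ) ≠ 0 := by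
      exact_mod_cast (Nat.choose_pos hi').ne'
    simp only [hF, hE]
    rw [show n - i + 1 = (n - i) + 1 from rfl, hfac, Nat.factorial_succ]
    push_cast
    field_simp
  -- step 2: substitute the inversion and exchange the sums
  rw [h1]
  have h2 : ∀ i ∈ range (n + 1), ((i : ℂ) + 1) * 2 ^ i * ((-1) ^ (n - i) * F (n - i)) =
      ∑ j ∈ range (n - i + 1), ((i : ℂ) + 1) * 2 ^ i * ((n + 1 - i).choose (j + 1) : ℂ) *
        ((-1) ^ j * L j) := by
    intro i hi
    simp only [Finset.mem_range] at hi
    rw [hinv (n - i), Finset.mul_sum, Finset.mul_sum]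
    refine Finset.sum_congr rfl fun j hj ↦ ?_
    simp only [Finset.mem_range] at hj
    rw [show n + 1 - i = n - i + 1 from by omega]
    have hs := neg_one_pow_mul_neg_one_pow_sub (R := ℂ) (Nat.lt_succ_iff.1 hj)
    linear_combination (((i : ℂ) + 1) * 2 ^ i * ((n - i + 1).choose (j + 1) : ℂ) * L j) * hs
  rw [Finset.sum_congr rfl h2,
    Finset.sum_comm' (t' := range (n + 1)) (s' := fun j ↦ range (n + 1 - j))
      (fun i j ↦ by simp only [Finset.mem_range]; omega)]
  refine Finset.sum_congr rfl fun j _ ↦ ?_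
  rw [Finset.sum_mul, Finset.sum_mul]
  refine Finset.sum_congr rfl fun i _ ↦ ?_
  ring

/-- RH-FREE. **Suzuki2023 Thm 8.1, (8.3)** PROVED:
`μ_n/n! = ∑_{j=1}^{n+1} [∑_{k=1}^{n-j+2} k 2^{k-1} C(n-k+2, j)] (-1)^{j+1} λ_j` for every `n ≥ 0`.
Discharges `Suzuki2023_thm81_inv`. [cite: Suzuki2023, Thm 8.1 (8.3), p. 18 (arXiv p0018:L25–35)] -/
theorem thm81_inv : Suzuki2023_thm81_inv := by
  intro n
  have key : (((zetaScrewMoment n / (n ! : ℝ) : ℝ)) : ℂ) =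
      ∑ j ∈ range (n + 1),
        (((∑ i ∈ range (n + 1 - j), ((i : ℝ) + 1) * 2 ^ i * ((n + 1 - i).choose (j + 1) : ℝ)) *
          (-1) ^ j : ℝ) : ℂ) *
          (iteratedDeriv (j + 1) (fun s : ℂ ↦ s ^ (j + 1 - 1) * Complex.log (riemannXi s)) 1 /
            (j ! : ℂ)) := by
    push_cast
    exact moment_div_factorial_eq n
  have hre := congrArg Complex.re key
  simp only [Complex.ofReal_re, Complex.re_sum, Complex.re_ofReal_mul] at hre
  rw [hre]
  symm
  rw [← Finset.Ico_add_one_right_eq_Icc, Finset.sum_Ico_eq_sum_range,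
    show n + 1 + 1 - 1 = n + 1 from rfl]
  refine Finset.sum_congr rfl fun j hj ↦ ?_
  simp only [Finset.mem_range] at hj
  rw [← Finset.Ico_add_one_right_eq_Icc, Finset.sum_Ico_eq_sum_range,
    show n + 2 - (1 + j) + 1 - 1 = n + 1 - j from by omega, Nat.add_comm 1 j, keiperLiCoeff,
    Nat.add_sub_cancel]
  congr 1
  congr 1
  · refine Finset.sum_congr rfl fun i hi ↦ ?_
    simp only [Finset.mem_range] at hi
    rw [show n + 2 - (1 + i) = n + 1 - i from by omega, show 1 + i - 1 = i from by omega]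
    push_cast
    ring
  · rw [pow_succ, pow_succ]
    ring

/-! ### I.5 Thm 8.1, (8.1)–(8.2): the Li coefficients in terms of the moments -/

/-- **(8.2) over `ℂ`, un-normalised**: `(1/N!)·d^{N+1}/ds^{N+1}[s^N log ξ(s)](1)
= ∑_{k ≤ N} [C(N+1,k+1) + 4C(N+1,k+2) + 4C(N+1,k+3)]/k! · (-1)^k μ_k`.
Road: (1.14) at `s = 1` (`keiper_div_factorial_eq`), (1.15) read backwards (`e_succ_eq`), and the
regrouping `sum_three_term_regroup` — in place of the printed expansion (8.5) of
`(1+w)²(1-w)^{-4}exp(-t(1+w)/(2(1-w)))`. [cite: Suzuki2023, Thm 8.1 (8.1)–(8.2), p. 18] -/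
theorem keiper_div_factorial_eq_sum_moments (N : ℕ) :
    iteratedDeriv (N + 1) (fun s : ℂ ↦ s ^ (N + 1 - 1) * Complex.log (riemannXi s)) 1 / (N ! : ℂ) =
      ∑ k ∈ range (N + 1),
        ((((N + 1).choose (k + 1) : ℂ) + 4 * ((N + 1).choose (k + 2) : ℂ) +
          4 * ((N + 1).choose (k + 3) : ℂ)) / (k ! : ℂ) * (-1) ^ k) * (zetaScrewMoment k : ℂ) := by
  rw [keiper_div_factorial_eq]
  set c : ℕ → ℂ := fun j ↦ ((N + 1).choose (j + 1) : ℂ) * (-1) ^ j / (j ! : ℂ) with hc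
  have hterm : ∀ j ∈ range (N + 1),
      ((N + 1).choose (j + 1) : ℂ) *
        (iteratedDeriv (j + 1) (fun s : ℂ ↦ Complex.log (riemannXi s)) 1 / (j ! : ℂ)) =
      c j * (zetaScrewMoment j : ℂ) + (-4 * j * c j) * (zetaScrewMoment (j - 1) : ℂ) +
        (4 * j * ((j : ℂ) - 1) * c j) * (zetaScrewMoment (j - 2) : ℂ) := by
    intro j _
    have he := e_succ_eq j
    have hsq : ((-1 : ℂ) ^ j) * (-1) ^ j = 1 := by rw [← mul_pow]; norm_num
    have : iteratedDeriv (j + 1) (fun s : ℂ ↦ Complex.log (riemannXi s)) 1 =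
        (-1) ^ j * ((zetaScrewMoment j : ℂ) - 4 * j * (zetaScrewMoment (j - 1) : ℂ) +
          4 * j * ((j : ℂ) - 1) * (zetaScrewMoment (j - 2) : ℂ)) := by
      rw [← he, ← mul_assoc, hsq, one_mul]
    rw [this, hc]
    ring
  rw [Finset.sum_congr rfl hterm,
    sum_three_term_regroup (M := N + 1) _ _ _ _ (by simp) (by simp) (by simp)
      (by simp [hc]) (by simp [hc])
      (by simp [hc, Nat.choose_eq_zero_of_lt (by omega : N + 1 < N + 2 + 1)])]
  refine Finset.sum_congr rfl fun k _ ↦ ?_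
  simp only [hc]
  have hk1 : (k ! : ℂ) ≠ 0 := by exact_mod_cast Nat.factorial_ne_zero _
  have hk2 : ((k + 1 : ℕ) : ℂ) ≠ 0 := by exact_mod_cast Nat.succ_ne_zero k
  have hk3 : ((k + 1 + 1 : ℕ) : ℂ) ≠ 0 := by exact_mod_cast Nat.succ_ne_zero (k + 1)
  push_cast at hk2 hk3
  rw [Nat.factorial_succ (k + 1), Nat.factorial_succ k]
  push_cast
  field_simp
  ring

/-- The coefficient identity behind (8.2): for `k ≤ N` (so `n = N+1 ≥ k+1`),
`[C(n,k+1) + 4C(n,k+2) + 4C(n,k+3)]/(k! n!) = [(k - (4n-1)/2)² + 2n + 7/4]/(k!(k+3)!(n-k-1)!)`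
("by elementary calculations", p. 18). [cite: Suzuki2023, Thm 8.1 (8.2), p. 18] -/
theorem coeff_82 (N k : ℕ) (hk : k ≤ N) :
    (((N + 1).choose (k + 1) : ℂ) + 4 * ((N + 1).choose (k + 2) : ℂ) +
        4 * ((N + 1).choose (k + 3) : ℂ)) / (k ! : ℂ) / ((N + 1)! : ℂ) =
      1 / ((k ! : ℂ) * ((k + 3)! : ℂ) * ((N - k)! : ℂ)) *
        (((k : ℂ) - (4 * ((N : ℂ) + 1) - 1) / 2) ^ 2 + 2 * ((N : ℂ) + 1) + 7 / 4) := by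
  have hk0 : (k ! : ℂ) ≠ 0 := by exact_mod_cast Nat.factorial_ne_zero _
  have hka : ((k + 1 : ℕ) : ℂ) ≠ 0 := by exact_mod_cast Nat.succ_ne_zero k
  have hkb : ((k + 1 + 1 : ℕ) : ℂ) ≠ 0 := by exact_mod_cast Nat.succ_ne_zero (k + 1)
  have hkc : ((k + 2 + 1 : ℕ) : ℂ) ≠ 0 := by exact_mod_cast Nat.succ_ne_zero (k + 2)
  push_cast at hka hkb hkc
  obtain ⟨d, rfl⟩ := Nat.exists_eq_add_of_le hk
  rcases d with _ | _ | d
  · -- `N = k`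
    simp only [add_zero, Nat.sub_self, Nat.choose_self, Nat.cast_one,
      Nat.choose_eq_zero_of_lt (by omega : k + 1 < k + 2),
      Nat.choose_eq_zero_of_lt (by omega : k + 1 < k + 3), Nat.cast_zero, mul_zero, add_zero,
      Nat.factorial_zero, mul_one]
    rw [Nat.factorial_succ (k + 2), Nat.factorial_succ (k + 1), Nat.factorial_succ k]
    push_cast
    field_simp
    ring
  · -- `N = k + 1`
    rw [show k + (0 + 1) = k + 1 from rfl, show k + 1 - k = 1 from by omega,
      show k + 1 + 1 = k + 2 from rfl, Nat.choose_self,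
      Nat.choose_eq_zero_of_lt (by omega : k + 2 < k + 3),
      show (k + 2).choose (k + 1) = k + 2 from Nat.choose_succ_self_right (k + 1)]
    simp only [Nat.cast_one, Nat.cast_zero, mul_zero, add_zero, Nat.factorial_one, mul_one]
    rw [Nat.factorial_succ (k + 2), Nat.factorial_succ (k + 1), Nat.factorial_succ k]
    push_cast
    field_simp
    ring
  · -- `N = k + d + 2`
    rw [show k + (d + 1 + 1) - k = d + 2 from by omega,
      show k + (d + 1 + 1) + 1 = k + d + 3 from by omega,
      Nat.cast_choose ℂ (by omega : k + 1 ≤ k + d + 3),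
      Nat.cast_choose ℂ (by omega : k + 2 ≤ k + d + 3),
      Nat.cast_choose ℂ (by omega : k + 3 ≤ k + d + 3),
      show k + d + 3 - (k + 1) = d + 2 from by omega, show k + d + 3 - (k + 2) = d + 1 from by omega,
      show k + d + 3 - (k + 3) = d from by omega]
    have h1 : ((k + 1)! : ℂ) ≠ 0 := by exact_mod_cast Nat.factorial_ne_zero _
    have h2 : ((k + 2)! : ℂ) ≠ 0 := by exact_mod_cast Nat.factorial_ne_zero _
    have h3 : ((k + 3)! : ℂ) ≠ 0 := by exact_mod_cast Nat.factorial_ne_zero _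
    have h4 : (d ! : ℂ) ≠ 0 := by exact_mod_cast Nat.factorial_ne_zero _
    have h5 : ((d + 1)! : ℂ) ≠ 0 := by exact_mod_cast Nat.factorial_ne_zero _
    have h6 : ((d + 2)! : ℂ) ≠ 0 := by exact_mod_cast Nat.factorial_ne_zero _
    have h7 : ((k + d + 3)! : ℂ) ≠ 0 := by exact_mod_cast Nat.factorial_ne_zero _
    have hda : ((d + 1 : ℕ) : ℂ) ≠ 0 := by exact_mod_cast Nat.succ_ne_zero d
    have hdb : ((d + 1 + 1 : ℕ) : ℂ) ≠ 0 := by exact_mod_cast Nat.succ_ne_zero (d + 1)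
    push_cast at hda hdb
    push_cast
    rw [Nat.factorial_succ (k + 2), Nat.factorial_succ (k + 1), Nat.factorial_succ k,
      Nat.factorial_succ (d + 1), Nat.factorial_succ d]
    push_cast
    field_simp
    ring

/-- RH-FREE. **Suzuki2023 Thm 8.1, (8.1)–(8.2)** PROVED:
`(1/n!)λ_n = ∑_{k=0}^{n-1} [k!(k+3)!(n-k-1)!]^{-1}((k-(4n-1)/2)² + 2n + 7/4)(-1)^k μ_k` for every
`n ≥ 1` ((8.1) being the cases `n = 1,2,3`, `Suzuki2023_thm81_cases`). Discharges `Suzuki2023_thm81`.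
[cite: Suzuki2023, Thm 8.1 (8.1)–(8.2), p. 18 (arXiv p0018:L8–24)] -/
theorem thm81 : Suzuki2023_thm81 := by
  intro n hn
  obtain ⟨N, rfl⟩ : ∃ N, n = N + 1 := ⟨n - 1, by omega⟩
  have key : iteratedDeriv (N + 1) (fun s : ℂ ↦ s ^ (N + 1 - 1) * Complex.log (riemannXi s)) 1 /
      (N ! : ℂ) / ((N + 1)! : ℂ) = ((suzukiLiOfMoments zetaScrewMoment (N + 1) : ℝ) : ℂ) := by
    rw [keiper_div_factorial_eq_sum_moments, Finset.sum_div, suzukiLiOfMoments]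
    push_cast
    refine Finset.sum_congr rfl fun k hk ↦ ?_
    simp only [Finset.mem_range] at hk
    rw [show N + 1 - k - 1 = N - k from by omega, ← coeff_82 N k (Nat.lt_succ_iff.1 hk)]
    ring
  have hre := congrArg Complex.re key
  rw [Complex.ofReal_re, Complex.div_natCast_re] at hre
  rw [← hre, keiperLiCoeff, Nat.add_sub_cancel]

/-! ### I.6 Thm 8.2: positivity of `b_{n,k}` and the recurrence (8.9) -/

/-- `a_j ≥ 0` (Li's positivity, tree: `iteratedDeriv_liPhi_zero_nonneg`). [cite: Suzuki2023, Thm 8.2 (proof), p. 19; Li1997] -/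
theorem liXiCoeff_nonneg (j : ℕ) : 0 ≤ liXiCoeff j := by
  have h := iteratedDeriv_liPhi_zero_nonneg xiTaylorCoeff_pos_holds j
  obtain ⟨hre, -⟩ := Complex.nonneg_iff.mp h
  rw [liXiCoeff, mul_div_assoc, show (2 : ℂ) = ((2 : ℝ) : ℂ) from by norm_num, Complex.re_ofReal_mul,
    Complex.div_natCast_re]
  positivity

/-- **Positivity of `b_{n,k}`** (for all `n, k`; the source states it for `n ≥ 1`, `k ≤ n`).
[cite: Suzuki2023, Thm 8.2, p. 19] -/
theorem suzukiB_pos (n k : ℕ) : 0 < suzukiB n k := by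
  unfold suzukiB
  refine mul_pos (by positivity) (add_pos_of_pos_of_nonneg (by positivity) ?_)
  exact Finset.sum_nonneg fun j _ ↦ mul_nonneg (by positivity) (liXiCoeff_nonneg _)

/-- `a_j = 2 c_j(0)` (Freitas' Taylor coefficients of `φ = liPhi` at `0`; Suzuki's `a_j` are those of
`2φ = ξ(1/(1-w))/ξ(1)`). [cite: Suzuki2023, Thm 8.2, p. 19; Freitas2006LiHalfPlanes, Remark 2.5] -/
theorem liXiCoeff_eq_freitasC (j : ℕ) : liXiCoeff j = 2 * freitasC 0 j := by
  rw [liXiCoeff, freitasC, mul_div_assoc, show (2 : ℂ) = ((2 : ℝ) : ℂ) from by norm_num,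
    Complex.re_ofReal_mul, Complex.ofReal_zero]

/-- **Li's recurrence (8.10)**: `λ_{n+1} = (n+1)a_{n+1} - ∑_{j=1}^{n} a_{n-j+1}λ_j` for every
`n ≥ 0` — the tree's `Freitas2006_recurrence_holds` at `z₀ = 0` (`φ' = φ·ψ`), with
`d_m(0) = λ_{m+1}` (`Freitas2006_lemma_3_1_ii_holds` at `τ = 1`, `freitasAlpha_one`), `c₀(0) = 1/2`.
[cite: Suzuki2023, (8.10), p. 19; Li1997] -/
theorem li_recurrence (n : ℕ) :
    keiperLiCoeff (n + 1) = (n + 1) * liXiCoeff (n + 1) -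
      ∑ j ∈ Finset.Icc 1 n, liXiCoeff (n + 1 - j) * keiperLiCoeff j := by
  have hD : ∀ m : ℕ, freitasD 0 m = keiperLiCoeff (m + 1) := by
    intro m
    have h := Freitas2006_lemma_3_1_ii_holds (m + 1) (by omega) 1 one_ne_zero
    simp only [div_one, sub_self, one_pow, one_mul, Nat.add_sub_cancel, freitasAlpha_one] at h
    exact h
  have hC0 : freitasC 0 0 = 1 / 2 := by
    simp [freitasC, liPhi_zero]
  have hrec := Freitas2006_recurrence_holds 0 (by norm_num) (by norm_num) (n + 1) (by omega)
  rw [Nat.add_sub_cancel, hD, hC0] at hrec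
  rw [hrec, liXiCoeff_eq_freitasC, Finset.mul_sum]
  have hsum : ∑ j ∈ Finset.Icc 1 n, liXiCoeff (n + 1 - j) * keiperLiCoeff j =
      ∑ k ∈ Finset.Ico 1 (n + 1), (1 / 2 : ℝ)⁻¹ * (freitasC 0 k * freitasD 0 (n + 1 - k - 1)) := by
    refine Finset.sum_nbij' (fun j ↦ n + 1 - j) (fun k ↦ n + 1 - k)
      (fun j hj ↦ by simp only [Finset.mem_Icc, Finset.mem_Ico] at hj ⊢; omega)
      (fun k hk ↦ by simp only [Finset.mem_Icc, Finset.mem_Ico] at hk ⊢; omega)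
      (fun j hj ↦ by simp only [Finset.mem_Icc] at hj; omega)
      (fun k hk ↦ by simp only [Finset.mem_Ico] at hk; omega) (fun j hj ↦ ?_)
    simp only [Finset.mem_Icc] at hj
    rw [hD, show n + 1 - (n + 1 - j) - 1 + 1 = j from by omega, liXiCoeff_eq_freitasC]
    ring
  rw [hsum]
  push_cast
  ring

/-- How `b_{n,k}` arises ("grouping the right-hand side concerning moments `μ_k`"): with
`c(m,k) = [k!(k+3)!(m-k-1)!]^{-1}((k-(4m-1)/2)²+2m+7/4)` the coefficient of (8.2),
`b_{n,k} = n!(n+1)! c(n+1,k) + ∑_{j=k+1}^{n} n! j! c(j,k) a_{n-j+1}`. [cite: Suzuki2023, Thm 8.2, p. 19] -/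
theorem suzukiB_eq (n k : ℕ) (hk : k < n) :
    suzukiB n k =
      (n ! : ℝ) * ((n + 1)! : ℝ) *
          (1 / ((k ! : ℝ) * ((k + 3)! : ℝ) * ((n + 1 - k - 1)! : ℝ)) *
            (((k : ℝ) - (4 * ((n + 1 : ℕ) : ℝ) - 1) / 2) ^ 2 + 2 * ((n + 1 : ℕ) : ℝ) + 7 / 4)) +
        ∑ j ∈ Finset.Icc (k + 1) n, (n ! : ℝ) * (j ! : ℝ) *
          (1 / ((k ! : ℝ) * ((k + 3)! : ℝ) * ((j - k - 1)! : ℝ)) *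
            (((k : ℝ) - (4 * (j : ℝ) - 1) / 2) ^ 2 + 2 * (j : ℝ) + 7 / 4)) * liXiCoeff (n + 1 - j) := by
  unfold suzukiB
  rw [show n + 1 - k - 1 = n - k from by omega, mul_add, Finset.mul_sum]
  have hk0 : (k ! : ℝ) ≠ 0 := by exact_mod_cast Nat.factorial_ne_zero _
  have hk3 : ((k + 3)! : ℝ) ≠ 0 := by exact_mod_cast Nat.factorial_ne_zero _
  have hnk : ((n - k)! : ℝ) ≠ 0 := by exact_mod_cast Nat.factorial_ne_zero _
  congr 1
  · push_cast
    field_simp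
    ring
  · refine Finset.sum_congr rfl fun j _ ↦ ?_
    have hj : ((j - k - 1)! : ℝ) ≠ 0 := by exact_mod_cast Nat.factorial_ne_zero _
    field_simp
    ring

/-- **The recurrence (8.9)** from (8.2) (all `n ≥ 1`) and Li's recurrence (8.10):
`(-1)ⁿμ_n = (n+1)! a_{n+1} - ∑_{k<n} (-1)^k b_{n,k} μ_k` for every `n ≥ 0`.
[cite: Suzuki2023, Thm 8.2 (8.9), p. 19 (arXiv p0019:L25–40)] -/
theorem moments_recurrence (h81 : Suzuki2023_thm81) (n : ℕ) :
    (-1) ^ n * zetaScrewMoment n =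
      ((n + 1)! : ℝ) * liXiCoeff (n + 1) -
        ∑ k ∈ range n, (-1) ^ k * suzukiB n k * zetaScrewMoment k := by
  -- the coefficient of (8.2)
  set cc : ℕ → ℕ → ℝ := fun m k ↦
    1 / ((k ! : ℝ) * ((k + 3)! : ℝ) * ((m - k - 1)! : ℝ)) *
      (((k : ℝ) - (4 * m - 1) / 2) ^ 2 + 2 * m + 7 / 4) with hcc
  have h82 : ∀ m : ℕ, 1 ≤ m →
      keiperLiCoeff m = (m ! : ℝ) * ∑ k ∈ range m, cc m k * (-1) ^ k * zetaScrewMoment k := by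
    intro m hm
    have h := h81 m hm
    have hm0 : (m ! : ℝ) ≠ 0 := by exact_mod_cast Nat.factorial_ne_zero _
    rw [div_eq_iff hm0] at h
    rw [h, suzukiLiOfMoments, mul_comm]
  -- H1: Li's recurrence × n!
  have H1 : ((n + 1)! : ℝ) * liXiCoeff (n + 1) =
      (n ! : ℝ) * keiperLiCoeff (n + 1) +
        (n ! : ℝ) * ∑ j ∈ Finset.Icc 1 n, liXiCoeff (n + 1 - j) * keiperLiCoeff j := by
    rw [li_recurrence n, Nat.factorial_succ]
    push_cast
    ring
  -- H2: `n! λ_{n+1} = (-1)ⁿ μ_n + ∑_{k<n} n!(n+1)! c(n+1,k) (-1)^k μ_k`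
  have hcnn : (n ! : ℝ) * ((n + 1)! : ℝ) * cc (n + 1) n = 1 := by
    simp only [hcc, show n + 1 - n - 1 = 0 from by omega, Nat.factorial_zero, Nat.cast_one, mul_one]
    have h0 : (n ! : ℝ) ≠ 0 := by exact_mod_cast Nat.factorial_ne_zero _
    rw [Nat.factorial_succ (n + 2), Nat.factorial_succ (n + 1), Nat.factorial_succ n]
    push_cast
    field_simp
    ring
  have H2 : (n ! : ℝ) * keiperLiCoeff (n + 1) =
      (-1) ^ n * zetaScrewMoment n +
        ∑ k ∈ range n, (n ! : ℝ) * ((n + 1)! : ℝ) * cc (n + 1) k * (-1) ^ k * zetaScrewMoment k := by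
    rw [h82 (n + 1) (by omega), Finset.sum_range_succ, mul_add, mul_add, Finset.mul_sum,
      Finset.mul_sum]
    have : (n ! : ℝ) * (((n + 1)! : ℝ) * (cc (n + 1) n * (-1) ^ n * zetaScrewMoment n)) =
        (-1) ^ n * zetaScrewMoment n := by
      linear_combination ((-1 : ℝ) ^ n * zetaScrewMoment n) * hcnn
    rw [this, add_comm]
    congr 1
    refine Finset.sum_congr rfl fun k _ ↦ ?_
    ring
  -- H3: the substituted sum, regrouped by `μ_k`
  have H3 : (n ! : ℝ) * ∑ j ∈ Finset.Icc 1 n, liXiCoeff (n + 1 - j) * keiperLiCoeff j =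
      ∑ k ∈ range n, (∑ j ∈ Finset.Icc (k + 1) n,
        (n ! : ℝ) * (j ! : ℝ) * cc j k * liXiCoeff (n + 1 - j)) * (-1) ^ k * zetaScrewMoment k := by
    have hj : ∀ j ∈ Finset.Icc 1 n, liXiCoeff (n + 1 - j) * keiperLiCoeff j =
        ∑ k ∈ range j, liXiCoeff (n + 1 - j) * (j ! : ℝ) * (cc j k * (-1) ^ k * zetaScrewMoment k) := by
      intro j hj
      simp only [Finset.mem_Icc] at hj
      rw [h82 j hj.1, Finset.mul_sum, Finset.mul_sum]
      refine Finset.sum_congr rfl fun k _ ↦ ?_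
      ring
    rw [Finset.sum_congr rfl hj]
    simp_rw [Finset.mul_sum]
    rw [Finset.sum_comm' (t' := range n) (s' := fun k ↦ Finset.Icc (k + 1) n)
        (fun j k ↦ by simp only [Finset.mem_range, Finset.mem_Icc]; omega)]
    refine Finset.sum_congr rfl fun k _ ↦ ?_
    rw [Finset.sum_mul, Finset.sum_mul]
    refine Finset.sum_congr rfl fun j _ ↦ ?_
    ring
  -- H4: the coefficients are `b_{n,k}`
  have H4 : ∀ k ∈ range n, (-1) ^ k * suzukiB n k * zetaScrewMoment k =
      (n ! : ℝ) * ((n + 1)! : ℝ) * cc (n + 1) k * (-1) ^ k * zetaScrewMoment k +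
        (∑ j ∈ Finset.Icc (k + 1) n, (n ! : ℝ) * (j ! : ℝ) * cc j k * liXiCoeff (n + 1 - j)) *
          (-1) ^ k * zetaScrewMoment k := by
    intro k hk
    simp only [Finset.mem_range] at hk
    rw [suzukiB_eq n k hk]
    simp only [hcc]
    push_cast
    ring
  rw [Finset.sum_congr rfl H4, Finset.sum_add_distrib]
  linear_combination -H1 - H2 - H3

end ZetaScrewLiMoments

/-- RH-FREE. **Suzuki2023 Thm 8.1, (8.1)–(8.2)** DISCHARGED: for every `n ≥ 1`,
`(1/n!)λ_n = ∑_{k=0}^{n-1}[k!(k+3)!(n-k-1)!]^{-1}((k-(4n-1)/2)²+2n+7/4)(-1)^kμ_k`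
(`λ_n = keiperLiCoeff n`, `μ_k = zetaScrewMoment k`). [cite: Suzuki2023, Thm 8.1 (8.1)–(8.2), p. 18 (arXiv p0018:L8–24)] -/
theorem Suzuki2023_thm81_holds : Suzuki2023_thm81 :=
  ZetaScrewLiMoments.thm81

/-- RH-FREE. **Suzuki2023 Thm 8.1, (8.3)** DISCHARGED: for every `n ≥ 0`,
`(1/n!)μ_n = ∑_{j=1}^{n+1}[∑_{k=1}^{n-j+2} k2^{k-1}C(n-k+2,j)](-1)^{j+1}λ_j`.
[cite: Suzuki2023, Thm 8.1 (8.3), p. 18 (arXiv p0018:L25–35)] -/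
theorem Suzuki2023_thm81_inv_holds : Suzuki2023_thm81_inv :=
  ZetaScrewLiMoments.thm81_inv

/-- RH-FREE. **Suzuki2023 Thm 8.2** DISCHARGED: all `b_{n,k}` (`suzukiB n k`) are positive and
`(-1)ⁿμ_n = (n+1)!a_{n+1} - ∑_{k=0}^{n-1}(-1)^k b_{n,k}μ_k` for every `n ≥ 0` (`a_j = liXiCoeff j`).
[cite: Suzuki2023, Thm 8.2 and (8.9), p. 19 (arXiv p0019:L7–40)] -/
theorem Suzuki2023_thm82_holds : Suzuki2023_thm82 :=
  ⟨fun n k _ _ ↦ ZetaScrewLiMoments.suzukiB_pos n k,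
    ZetaScrewLiMoments.moments_recurrence Suzuki2023_thm81_holds⟩

/-- RH-FREE. **Li's recurrence (8.10)** as a tree theorem about `keiperLiCoeff` and `liXiCoeff`:
`λ_{n+1} = (n+1)a_{n+1} - ∑_{j=1}^{n} a_{n-j+1}λ_j` for every `n ≥ 0`.
[cite: Suzuki2023, (8.10), p. 19; Li1997] -/
theorem keiperLiCoeff_succ_eq_liXiCoeff (n : ℕ) :
    keiperLiCoeff (n + 1) = (n + 1) * liXiCoeff (n + 1) -
      ∑ j ∈ Finset.Icc 1 n, liXiCoeff (n + 1 - j) * keiperLiCoeff j :=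
  ZetaScrewLiMoments.li_recurrence n

end Literature.NumberTheory.LFunctions

end
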